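import Mathlib.Algebra.Order.BigOperators.Group.Finset
import Mathlib.Algebra.BigOperators.Ring.Finset
import Mathlib.Data.Fintype.Powerset
import Mathlib.Data.Real.Basic
import Mathlib.Order.Disjoint
import Literature.Probability.Moments.ChangInequalityDensities
import HarnessLib

/-!
# Razborov's corruption lemma for UNIQUE DISJOINTNESS (rectangle / measure form) — named fact, DISCHARGED

A. A. Razborov, *On the distributional complexity of disjointness*, Theoret. Comput. Sci. **106**
(1992) 385–390, Main Lemma: let `n = 4ℓ − 1`; write `A` for the pairs `(a, b)` of `ℓ`-subsets of
`[n]` with `a ∩ b = ∅` and `B` for the pairs of `ℓ`-subsets with `|a ∩ b| = 1`, and let `μ_A`, `μ_B`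
be the uniform probability measures on `A` and `B` (Razborov's `μ` is the mixture `¾ μ_A + ¼ μ_B`,
generated by a uniformly random partition `[n] = z_a ⊔ z_b ⊔ {i}`, `|z_a| = |z_b| = 2ℓ − 1`).  Then
there are absolute constants `α, δ > 0` such that EVERY combinatorial rectangle `R = X × Y ⊆ 2^[n] × 2^[n]`
satisfies `μ_B(R) ≥ α · μ_A(R) − 2^{−δ n}`: a rectangle that holds a noticeable fraction of the
disjoint pairs holds a proportional fraction of the barely-intersecting pairs ("corruption", one-sided
discrepancy).  The explicit, strengthened form read first-hand here is Braun–Fiorini–Pokutta–Steurer,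
*Approximation limits of linear programs (beyond hierarchies)*, FOCS 2012 = arXiv:1204.0957, §3.1
**Lemma 4** (rectangle case, p. 9): for `n ≡ 3 (mod 4)`, `ℓ = (n+1)/4`, `μ_A`, `μ_B` as above and every
`0 < ε < 1`,
`(1 − ε) · μ_A(R) − μ_B(R) ≤ 2^{−(ε²/(16 ln 2)) ℓ + O(log ℓ)}` with an absolute `O`-constant
("which is a strengthened version of Razborov's original lemma"); Kushilevitz–Nisan, *Communication
Complexity* (1996) §4.6 gives the textbook proof of the original.

## What is vendored

`udisjCorruption` — the lemma in the RECTANGLE / MEASURE form its extension-complexity users need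
(Fiorini et al.; Braun et al. 2012 §4; Rothvoß' hyperplane-separation bound
`RectangleCorruptionBound.rank_bound_of_corruption` in this directory): constants `m ≥ 1`, `κ ≥ 0`,
`A ≥ 0` and, for EVERY `n`, non-negative weights `μd` on the disjoint pairs of subsets of `[n]` (total
mass `1`) and `μo` on the pairs with `|a ∩ b| = 1` and `|a| = |b| = ⌊(n+1)/4⌋` (total mass `≤ 1`) with
`μd(X × Y) ≤ κ · μo(X × Y) + A / 2^{⌊n/m⌋}` for all rectangles.  This is a COROLLARY-SHAPED statement,
weaker than print in three inessential ways, each absorbed by the existential constants: (i) take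
`ε = 1/2` in BFPS Lemma 4, so `κ = 2` and the error is `2 · 2^{−ℓ/(64 ln 2) + O(log ℓ)}`; (ii) for `n`
not of the form `4ℓ − 1` use Razborov's measures on the first `n' = 4⌊(n+1)/4⌋ − 1 ≤ n` coordinates
(so `|a| = |b| = ℓ = ⌊(n+1)/4⌋` still), losing at most `3` coordinates in the exponent; (iii) small
`n` (and `n ≤ 2`, where `μo = 0` is forced) are absorbed by `A ≥ 1`; `2^{⌊n/m⌋} ≤ 2^{n/m}` only weakens
the error term.  The Lean statement is, token for token, the hypothesis `UDISJCorruption` of the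
VIRTUAL-PASSENGER line of `Summits/ValiantsHypothesis/…/Cruxes/NNDivisionHard/` (its KNOWN stub
`stub_udisjCorruption`), so `(h : udisjCorruption)` feeds that line by `exact h`.

* `udisjCorruption.noCard` — the same statement without the cardinality clause on `μo` (the older
  signature of the line), a one-line consequence.
PROVED below (second half of this file, namespace `UdisjFrames`): the port of Razborov's partition-frame
argument in the form of BFPS 2012 §3.1 Steps 1–4, for arbitrary rank-one non-negative kernels
(`UdisjFrames.corruption_rankOne`, the un-normalised Lemma 4), its rectangle case
(`UdisjFrames.rect_corruption`) and the discharge `udisjCorruption_holds`.  NOT here: the `Ω(n)`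
randomized lower bound for DISJ that follows (Kalyanasundaram–Schnitger; Razborov); the
non-negative-rank / extension-complexity consequences (BFPS Theorem 5 and Theorem 6 live with their
polytopes in `Literature/Combinatorics/Optimization/UdisjShiftNonnegativeRank.lean`).

## References

* A. A. Razborov, *On the distributional complexity of disjointness*, TCS 106 (1992) 385–390,
  Main Lemma [Razborov1992Disjointness].
* G. Braun, S. Fiorini, S. Pokutta, D. Steurer, *Approximation limits of linear programs (beyond
  hierarchies)*, FOCS 2012 (arXiv:1204.0957), §3.1 Lemma 4 [BraunEtAl2012].
* E. Kushilevitz, N. Nisan, *Communication Complexity*, CUP 1996, §4.6 [KushilevitzNisan1996].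
-/

namespace Literature.Computability.Complexity

open Finset

/-- **Razborov's corruption lemma for unique disjointness, rectangle / measure form (named fact).**
There are constants `m ≥ 1`, `κ ≥ 0`, `A ≥ 0` such that for every `n` there are weights
`μd, μo : 2^[n] × 2^[n] → ℝ≥0`, `μd` supported on the DISJOINT pairs with total mass `1`, `μo` supported
on the pairs with `|a ∩ b| = 1` and `|a| = |b| = ⌊(n+1)/4⌋` with total mass `≤ 1`, such that every
rectangle `X × Y` has `μd(X × Y) ≤ κ · μo(X × Y) + A / 2^{⌊n/m⌋}`.  Witnessed by Razborov's uniform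
measures on disjoint / barely-intersecting pairs of `ℓ`-sets, `n' = 4ℓ − 1 ≤ n` (Main Lemma:
`μ_B(R) ≥ α μ_A(R) − 2^{−δn}`), in the explicit form of Braun–Fiorini–Pokutta–Steurer 2012, Lemma 4
with `ε = 1/2`: `½ μ_A(R) − μ_B(R) ≤ 2^{−ℓ/(64 ln 2) + O(log ℓ)}`.
[cite: Razborov1992Disjointness, Main Lemma; explicit form BraunEtAl2012 §3.1 Lemma 4 (arXiv:1204.0957 p. 9)] -/
def udisjCorruption : Prop :=
  ∃ (m : ℕ) (κ A : ℝ), 0 < m ∧ 0 ≤ κ ∧ 0 ≤ A ∧ ∀ n : ℕ,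
    ∃ μd μo : Finset (Fin n) → Finset (Fin n) → ℝ,
      (∀ a b, 0 ≤ μd a b) ∧ (∀ a b, 0 ≤ μo a b) ∧
      (∀ a b, μd a b ≠ 0 → Disjoint a b) ∧ (∀ a b, μo a b ≠ 0 → (a ∩ b).card = 1) ∧
    (∀ a b, μo a b ≠ 0 → a.card = (n + 1) / 4 ∧ b.card = (n + 1) / 4) ∧
      (∑ a, ∑ b, μd a b = 1) ∧ (∑ a, ∑ b, μo a b ≤ 1) ∧
      ∀ X Y : Finset (Finset (Fin n)),
        ∑ a ∈ X, ∑ b ∈ Y, μd a b ≤ κ * ∑ a ∈ X, ∑ b ∈ Y, μo a b + A / 2 ^ (n / m)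

/-- The corruption pair WITHOUT the cardinality clause on `μo` (the line's older signature): drop one
conjunct. [cite: Razborov1992Disjointness, Main Lemma] -/
theorem udisjCorruption.noCard (h : udisjCorruption) :
    ∃ (m : ℕ) (κ A : ℝ), 0 < m ∧ 0 ≤ κ ∧ 0 ≤ A ∧ ∀ n : ℕ,
      ∃ μd μo : Finset (Fin n) → Finset (Fin n) → ℝ,
        (∀ a b, 0 ≤ μd a b) ∧ (∀ a b, 0 ≤ μo a b) ∧
        (∀ a b, μd a b ≠ 0 → Disjoint a b) ∧ (∀ a b, μo a b ≠ 0 → (a ∩ b).card = 1) ∧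
        (∑ a, ∑ b, μd a b = 1) ∧ (∑ a, ∑ b, μo a b ≤ 1) ∧
        ∀ X Y : Finset (Finset (Fin n)),
          ∑ a ∈ X, ∑ b ∈ Y, μd a b ≤ κ * ∑ a ∈ X, ∑ b ∈ Y, μo a b + A / 2 ^ (n / m) := by
  obtain ⟨m, κ, A, hm, hκ, hA, h⟩ := h
  refine ⟨m, κ, A, hm, hκ, hA, fun n => ?_⟩
  obtain ⟨μd, μo, h1, h2, h3, h4, -, h6, h7, h8⟩ := h n
  exact ⟨μd, μo, h1, h2, h3, h4, h6, h7, h8⟩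


/-! ## The proof: Razborov's partition frames, BFPS 2012 §3.1 Steps 1–4, and the discharge

Everything below is PROVED (finite sums; no new definitions of mathematical content beyond the
bookkeeping vocabulary of the printed proof).  We follow Braun–Fiorini–Pokutta–Steurer 2012, §3.1,
proof of Lemma 4 (arXiv:1204.0957 pp. 9–11), with `ℓ = k + 1`:

* **Step 1 (the partition frames).**  A *frame* is `T = (T₁, T₂, i)`: disjoint `T₁, T₂ ⊆ [n]` with
  `|T₁| = |T₂| = 2ℓ − 1 = 2k + 1` and a pivot `i ∉ T₁ ∪ T₂` (p. 9: "a uniformly chosen partition of `[n]`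
  into two subsets `T₁, T₂` with `2ℓ − 1` elements each and one singleton `{i}`"; we do not insist on
  `T₁ ∪ T₂ ∪ {i} = [n]`, so every `n ≥ 4ℓ − 1` is covered without the printed "WLOG `n ≡ 3 (mod 4)`").
  Given `T`, `a` is a uniform `ℓ`-subset of `T₁ ∪ {i}` and `b` a uniform `ℓ`-subset of `T₂ ∪ {i}`,
  independently; `Row₀(T) = E[f(a) | i ∉ a]`, `Row₁(T) = E[f(a) | i ∈ a]` (p. 9 (3.3)–(3.4)) are the
  normalised sums `lo`, `hi` below (both index sets have `C(2k+1, k+1) = C(2k+1, k)` elements), and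
  `Col₀, Col₁` are `lo, hi` of the swapped frame.  The two functionals `sumA`, `sumB` are the
  un-normalised `E[X | A]·P` and `E[X | B]·P` of a kernel `X(a, b)` (p. 9 (3.7)–(3.8)): `sumB` sums
  `X(a, b)` over the frame pairs with `a ∩ b = {i}`, `sumA` over the three kinds of DISJOINT frame pairs.
* **Step 2 (p. 10 (3.15)).**  Pointwise, for non-negative reals,
  `Row_u Col_w − Row₁ Col₁ ≤ Row₀ |Col₀ − Col₁| + |Row₀ − Row₁| Col₀` for each of the three disjoint
  kinds `(u, w) ≠ (1, 1)` (`step_two`; via `Row₁ Col₁ ≥ min Row · min Col`, the printed "rectangle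
  trick").  DEVIATION: the print first symmetrises `E[X | A] = E[Row₀ Col₀]` ((3.9)–(3.14)); bounding the
  three kinds separately makes that identity unnecessary.
* **Step 3 (pp. 10–11, the entropy argument in the "big" case).**  For a window `W = T₁ ∪ {i}`
  (`|W| = 2ℓ`), `Row₀ − Row₁ = Σ_{x ∈ C(W, ℓ)} f(x) χ_i(x)` is `F · q̂({i})` for the density `q ∝ f` on the
  slice `C(W, ℓ) ⊆ {0,1}^W`; on the event `E_big` ("`E[f] > 2^{−δℓ−1} ‖f|_W‖_∞`") `q` is flat, and the
  printed subadditivity-of-entropy + Taylor-expansion estimate (3.19)–(3.27) is exactly the entropy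
  form of Chang's level-1 inequality — we invoke the tree's
  `Literature.Probability.Moments.sum_sq_cubeFourierCoeff_le_of_isTriangular` (Impagliazzo–Moore–Russell)
  for the singletons `{j}, j ∈ W`, with `4^ℓ ≤ 2ℓ·C(2ℓ, ℓ)` (Mathlib) supplying the printed
  `log C(2ℓ, ℓ) = 2ℓ(1 − O(log ℓ/ℓ))` ((3.21)); Cauchy–Schwarz then gives
  `Σ_{i ∈ W} |Row₀ − Row₁| ≤ 2F √(ℓ (κ + log 2ℓ))` (`sum_abs_lo_sub_hi_le`).
* **Step 4 (p. 11 (3.31)–(3.33), the "small" case)** is `term_le_of_small`.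
* Assembly (`corruption_rankOne`): for `0 < ε`, non-negative `f, g` with `f(a) g(b) ≤ N` whenever
  `|a ∩ b| ≤ 1`,  `(1 − ε)·sumA(f ⊗ g) − 3·sumB(f ⊗ g) ≤ 24 · 2ℓ · e^{−ε² ℓ/36} · N · sumB(1)`; in the
  normalised currency (`sumA(1) = 3·sumB(1)`) this is
  `(1 − ε) E[X | A] − E[X | B] ≤ 16 ℓ e^{−ε² ℓ / 36} ‖X‖_∞`, the printed (3.2) with the constant
  `1/36` in place of `1/(16 ln 2)` and `O(log ℓ) = log(16 ℓ)`.
* The rectangle / measure form `udisjCorruption` follows with `ε = 1/2` (`udisjCorruption_holds`).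

[cite: BraunEtAl2012, §3.1 Lemma 4 and its proof, Steps 1–4 (arXiv:1204.0957 pp. 9–11)]
[cite: Razborov1992Disjointness, Main Lemma] [cite: KushilevitzNisan1996, §4.6]
-/

noncomputable section

namespace UdisjFrames

open Real

variable {α : Type*} [DecidableEq α] [Fintype α]

/-! ### Step 1: frames, windows, the row sums and the two functionals -/

/-- The sign character `χ_a(x) = −1` if `a ∈ x` and `+1` otherwise (the Walsh character of the
singleton `{a}` evaluated at the indicator vector of `x`). [cite: BraunEtAl2012, §3.1 proof of Lemma 4,
Step 3 (the indicator `I_{j ∈ s}`, p. 11)] -/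
def chi (a : α) (x : Finset α) : ℝ := if a ∈ x then -1 else 1

/-- Razborov's partition frames `T = (T₁, T₂, i)`: `T₁, T₂` disjoint of size `2k + 1 = 2ℓ − 1` each and a
pivot `i` outside both. [cite: BraunEtAl2012, §3.1 proof of Lemma 4, Step 1 (p. 9)] -/
def frames (α : Type*) [DecidableEq α] [Fintype α] (k : ℕ) : Finset (Finset α × Finset α × α) :=
  Finset.univ.filter fun T => T.1.card = 2 * k + 1 ∧ T.2.1.card = 2 * k + 1 ∧ Disjoint T.1 T.2.1 ∧
    T.2.2 ∉ T.1 ∧ T.2.2 ∉ T.2.1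

/-- Windows `(W, T₂)`: `W = T₁ ∪ {i}` of size `2k + 2 = 2ℓ` and `T₂` of size `2k + 1`, disjoint (the data
a frame retains once the pivot is forgotten: "`[n] ∖ T₂`", p. 10). [cite: BraunEtAl2012, §3.1 proof of
Lemma 4, Step 1 (p. 10, conditioning on `T₂`)] -/
def windows (α : Type*) [DecidableEq α] [Fintype α] (k : ℕ) : Finset (Finset α × Finset α) :=
  Finset.univ.filter fun P => P.1.card = 2 * k + 2 ∧ P.2.card = 2 * k + 1 ∧ Disjoint P.1 P.2

/-- Exchanging the roles of rows and columns. [cite: BraunEtAl2012, §3.1 ("Exchanging the roles of rows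
and columns", p. 10)] -/
def swap (T : Finset α × Finset α × α) : Finset α × Finset α × α := (T.2.1, T.1, T.2.2)

/-- `Row₀(T)` un-normalised: the sum of `f` over the `ℓ`-subsets of `T₁` (the values of `a` with `i ∉ a`).
[cite: BraunEtAl2012, §3.1 (3.3) (p. 9)] -/
def lo (k : ℕ) (f : Finset α → ℝ) (T : Finset α × Finset α × α) : ℝ :=
  ∑ x ∈ T.1.powersetCard (k + 1), f x

/-- `Row₁(T)` un-normalised: the sum of `f(x ∪ {i})` over the `(ℓ−1)`-subsets `x` of `T₁` (the values of
`a` with `i ∈ a`). [cite: BraunEtAl2012, §3.1 (3.3) (p. 9)] -/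
def hi (k : ℕ) (f : Finset α → ℝ) (T : Finset α × Finset α × α) : ℝ :=
  ∑ x ∈ T.1.powersetCard k, f (insert T.2.2 x)

/-- The window sum `Σ_{x ∈ C(W, ℓ)} f(x)` (`= C(2ℓ, ℓ) · E[f(a) | T]`). [cite: BraunEtAl2012, §3.1 (3.5)
(p. 9)] -/
def full (k : ℕ) (f : Finset α → ℝ) (W : Finset α) : ℝ :=
  ∑ x ∈ W.powersetCard (k + 1), f x

/-- `sumA X`: the kernel `X` summed over the DISJOINT frame pairs `(a, b)` — the three kinds
`(i ∉ a, i ∉ b)`, `(i ∈ a, i ∉ b)`, `(i ∉ a, i ∈ b)` — over all frames (un-normalised `E[X | A]`).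
[cite: BraunEtAl2012, §3.1 (3.8) (p. 9)] -/
def sumA (k : ℕ) (X : Finset α → Finset α → ℝ) : ℝ :=
  ∑ T ∈ frames α k,
    (∑ x ∈ T.1.powersetCard (k + 1), ∑ y ∈ T.2.1.powersetCard (k + 1), X x y +
      ∑ x ∈ T.1.powersetCard k, ∑ y ∈ T.2.1.powersetCard (k + 1), X (insert T.2.2 x) y +
      ∑ x ∈ T.1.powersetCard (k + 1), ∑ y ∈ T.2.1.powersetCard k, X x (insert T.2.2 y))

/-- `sumB X`: the kernel `X` summed over the frame pairs with `a ∩ b = {i}` (un-normalised `E[X | B]`).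
[cite: BraunEtAl2012, §3.1 (3.7) (p. 9)] -/
def sumB (k : ℕ) (X : Finset α → Finset α → ℝ) : ℝ :=
  ∑ T ∈ frames α k, ∑ x ∈ T.1.powersetCard k, ∑ y ∈ T.2.1.powersetCard k,
    X (insert T.2.2 x) (insert T.2.2 y)

variable {k : ℕ}

/-- Unfolding membership in `frames`. [cite: BraunEtAl2012, §3.1 Step 1 (p. 9)] -/
theorem mem_frames {T : Finset α × Finset α × α} :
    T ∈ frames α k ↔ T.1.card = 2 * k + 1 ∧ T.2.1.card = 2 * k + 1 ∧ Disjoint T.1 T.2.1 ∧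
      T.2.2 ∉ T.1 ∧ T.2.2 ∉ T.2.1 := by
  simp [frames]

/-- Unfolding membership in `windows`. [cite: BraunEtAl2012, §3.1 Step 1 (p. 10)] -/
theorem mem_windows {P : Finset α × Finset α} :
    P ∈ windows α k ↔ P.1.card = 2 * k + 2 ∧ P.2.card = 2 * k + 1 ∧ Disjoint P.1 P.2 := by
  simp [windows]

/-- `swap` preserves frames. [cite: BraunEtAl2012, §3.1 (p. 10, "Exchanging the roles")] -/
theorem swap_mem_frames {T : Finset α × Finset α × α} (hT : T ∈ frames α k) : swap T ∈ frames α k := by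
  rcases mem_frames.1 hT with ⟨h1, h2, h3, h4, h5⟩
  exact mem_frames.2 ⟨h2, h1, h3.symm, h5, h4⟩

omit [DecidableEq α] [Fintype α] in
/-- `swap` is an involution. [cite: BraunEtAl2012, §3.1 (p. 10)] -/
@[simp] theorem swap_swap (T : Finset α × Finset α × α) : swap (swap T) = T := by
  rcases T with ⟨T₁, T₂, i⟩; rfl

/-- Frame pairs drawn from `T₁` and `T₂` are disjoint. [cite: BraunEtAl2012, §3.1 Step 1 (p. 9)] -/
theorem disjoint_of_mem {T : Finset α × Finset α × α} (hT : T ∈ frames α k) {j j' : ℕ} {x y : Finset α}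
    (hx : x ∈ T.1.powersetCard j) (hy : y ∈ T.2.1.powersetCard j') : Disjoint x y :=
  (mem_frames.1 hT).2.2.1.mono (Finset.mem_powersetCard.1 hx).1 (Finset.mem_powersetCard.1 hy).1

/-- The pivot is outside every subset of `T₁`. [cite: BraunEtAl2012, §3.1 Step 1 (p. 9)] -/
theorem pivot_notMem_left {T : Finset α × Finset α × α} (hT : T ∈ frames α k) {j : ℕ} {x : Finset α}
    (hx : x ∈ T.1.powersetCard j) : T.2.2 ∉ x :=
  fun h => (mem_frames.1 hT).2.2.2.1 ((Finset.mem_powersetCard.1 hx).1 h)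

/-- The pivot is outside every subset of `T₂`. [cite: BraunEtAl2012, §3.1 Step 1 (p. 9)] -/
theorem pivot_notMem_right {T : Finset α × Finset α × α} (hT : T ∈ frames α k) {j : ℕ} {y : Finset α}
    (hy : y ∈ T.2.1.powersetCard j) : T.2.2 ∉ y :=
  fun h => (mem_frames.1 hT).2.2.2.2 ((Finset.mem_powersetCard.1 hy).1 h)

/-- A `B`-pair meets exactly in the pivot. [cite: BraunEtAl2012, §3.1 Step 1 (p. 9, `P[B | T] = 1/4`)] -/
theorem card_inter_insert {T : Finset α × Finset α × α} (hT : T ∈ frames α k) {j j' : ℕ} {x y : Finset α}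
    (hx : x ∈ T.1.powersetCard j) (hy : y ∈ T.2.1.powersetCard j') :
    (insert T.2.2 x ∩ insert T.2.2 y).card = 1 := by
  rw [← Finset.insert_inter_distrib, Finset.disjoint_iff_inter_eq_empty.1 (disjoint_of_mem hT hx hy),
    Finset.insert_empty, Finset.card_singleton]

/-- An `A`-pair of the second kind is disjoint. [cite: BraunEtAl2012, §3.1 Step 1 (p. 9)] -/
theorem disjoint_insert_left_of_mem {T : Finset α × Finset α × α} (hT : T ∈ frames α k) {j j' : ℕ}
    {x y : Finset α} (hx : x ∈ T.1.powersetCard j) (hy : y ∈ T.2.1.powersetCard j') :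
    Disjoint (insert T.2.2 x) y :=
  Finset.disjoint_insert_left.2 ⟨pivot_notMem_right hT hy, disjoint_of_mem hT hx hy⟩

/-- An `A`-pair of the third kind is disjoint. [cite: BraunEtAl2012, §3.1 Step 1 (p. 9)] -/
theorem disjoint_insert_right_of_mem {T : Finset α × Finset α × α} (hT : T ∈ frames α k) {j j' : ℕ}
    {x y : Finset α} (hx : x ∈ T.1.powersetCard j) (hy : y ∈ T.2.1.powersetCard j') :
    Disjoint x (insert T.2.2 y) :=
  Finset.disjoint_insert_right.2 ⟨pivot_notMem_left hT hx, disjoint_of_mem hT hx hy⟩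

/-- Any pair `(x, y)` with `x ⊆ T₁ ∪ {i}`, `y ⊆ T₂ ∪ {i}` meets in at most the pivot.
[cite: BraunEtAl2012, §3.1 Step 4 (p. 11, the restriction to `A ∪ B`)] -/
theorem card_inter_le_one_of_subset {T : Finset α × Finset α × α} (hT : T ∈ frames α k) {x y : Finset α}
    (hx : x ⊆ insert T.2.2 T.1) (hy : y ⊆ insert T.2.2 T.2.1) : (x ∩ y).card ≤ 1 := by
  rcases mem_frames.1 hT with ⟨-, -, hd, -, -⟩
  have hsub : x ∩ y ⊆ {T.2.2} := by
    intro a ha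
    rw [Finset.mem_inter] at ha
    rw [Finset.mem_singleton]
    rcases Finset.mem_insert.1 (hx ha.1) with h | h
    · exact h
    rcases Finset.mem_insert.1 (hy ha.2) with h' | h'
    · exact h'
    exact absurd h' (Finset.disjoint_left.1 hd h)
  exact (Finset.card_le_card hsub).trans (Finset.card_singleton _).le

/-- `sumB` of a product kernel: `Σ_T Row₁ Col₁`. [cite: BraunEtAl2012, §3.1 (3.7) (p. 9)] -/
theorem sumB_mul (k : ℕ) (f g : Finset α → ℝ) :
    sumB k (fun a b => f a * g b) = ∑ T ∈ frames α k, hi k f T * hi k g (swap T) := by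
  unfold sumB hi swap
  refine Finset.sum_congr rfl fun T _ => ?_
  rw [Finset.sum_mul_sum]

/-- `sumA` of a product kernel: `Σ_T (Row₀ Col₀ + Row₁ Col₀ + Row₀ Col₁)`.
[cite: BraunEtAl2012, §3.1 (3.8) (p. 9)] -/
theorem sumA_mul (k : ℕ) (f g : Finset α → ℝ) :
    sumA k (fun a b => f a * g b) = ∑ T ∈ frames α k,
      (lo k f T * lo k g (swap T) + hi k f T * lo k g (swap T) + lo k f T * hi k g (swap T)) := by
  unfold sumA lo hi swap
  refine Finset.sum_congr rfl fun T _ => ?_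
  rw [Finset.sum_mul_sum, Finset.sum_mul_sum, Finset.sum_mul_sum]

/-- A kernel constant on disjoint pairs has `sumA X = c · sumA 1`. [cite: BraunEtAl2012, §3.2 proof of
Thm 5 ("`E[M | A] = ρ`", p. 12)] -/
theorem sumA_eq_of_disjoint {X : Finset α → Finset α → ℝ} {c : ℝ} (h : ∀ a b, Disjoint a b → X a b = c) :
    sumA k X = c * sumA (α := α) k (fun _ _ => 1) := by
  unfold sumA
  rw [Finset.mul_sum]
  refine Finset.sum_congr rfl fun T hT => ?_
  rw [mul_add, mul_add, Finset.mul_sum, Finset.mul_sum, Finset.mul_sum]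
  refine congrArg₂ _ (congrArg₂ _ ?_ ?_) ?_
  · refine Finset.sum_congr rfl fun x hx => ?_
    rw [Finset.mul_sum]
    exact Finset.sum_congr rfl fun y hy => by rw [h _ _ (disjoint_of_mem hT hx hy), mul_one]
  · refine Finset.sum_congr rfl fun x hx => ?_
    rw [Finset.mul_sum]
    exact Finset.sum_congr rfl fun y hy => by rw [h _ _ (disjoint_insert_left_of_mem hT hx hy), mul_one]
  · refine Finset.sum_congr rfl fun x hx => ?_
    rw [Finset.mul_sum]
    exact Finset.sum_congr rfl fun y hy => by rw [h _ _ (disjoint_insert_right_of_mem hT hx hy), mul_one]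

/-- A kernel constant on the pairs meeting in one point has `sumB X = c · sumB 1`.
[cite: BraunEtAl2012, §3.2 proof of Thm 5 ("`E[M | B] = ρ − 1`", p. 12)] -/
theorem sumB_eq_of_card_inter {X : Finset α → Finset α → ℝ} {c : ℝ}
    (h : ∀ a b, (a ∩ b).card = 1 → X a b = c) : sumB k X = c * sumB (α := α) k (fun _ _ => 1) := by
  unfold sumB
  rw [Finset.mul_sum]
  refine Finset.sum_congr rfl fun T hT => ?_
  rw [Finset.mul_sum]
  refine Finset.sum_congr rfl fun x hx => ?_
  rw [Finset.mul_sum]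
  exact Finset.sum_congr rfl fun y hy => by rw [h _ _ (card_inter_insert hT hx hy), mul_one]

/-- `C(2k+1, k+1) = C(2k+1, k)`: the two halves of a window slice have the same size
("`C(2ℓ−1, ℓ−1) = C(2ℓ−1, ℓ)`", p. 10). [cite: BraunEtAl2012, §3.1 Step 3 (p. 10)] -/
theorem choose_half (k : ℕ) : (2 * k + 1).choose (k + 1) = (2 * k + 1).choose k :=
  Nat.choose_symm_half k

/-- `sumA 1 = 3 · sumB 1` (all four kinds of frame pairs are equinumerous: `P[A] = 3/4`, `P[B] = 1/4`).
[cite: BraunEtAl2012, §3.1 Step 1 ("`P[A] = 3/4` and `P[B] = 1/4`", p. 9)] -/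
theorem sumA_one (k : ℕ) : sumA (α := α) k (fun _ _ => 1) = 3 * sumB (α := α) k (fun _ _ => 1) := by
  unfold sumA sumB
  rw [Finset.mul_sum]
  refine Finset.sum_congr rfl fun T hT => ?_
  rcases mem_frames.1 hT with ⟨h1, h2, -, -, -⟩
  simp only [Finset.sum_const, Finset.card_powersetCard, h1, h2, choose_half]
  ring

/-- `sumB 1 = |frames| · C(2k+1, k)²`. [cite: BraunEtAl2012, §3.1 Step 1 (p. 9)] -/
theorem sumB_one (k : ℕ) :
    sumB (α := α) k (fun _ _ => 1) = (frames α k).card * ((2 * k + 1).choose k : ℝ) ^ 2 := by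
  unfold sumB
  have : ∀ T ∈ frames α k, (∑ x ∈ T.1.powersetCard k, ∑ y ∈ T.2.1.powersetCard k, (1 : ℝ)) =
      ((2 * k + 1).choose k : ℝ) ^ 2 := by
    intro T hT
    rcases mem_frames.1 hT with ⟨h1, h2, -, -, -⟩
    simp only [Finset.sum_const, Finset.card_powersetCard, h1, h2]
    ring
  rw [Finset.sum_congr rfl this, Finset.sum_const, nsmul_eq_mul]

omit [DecidableEq α] [Fintype α] in
/-- Moving an inner sum over slots outside a double sum. [folklore] -/
private theorem sum_sum_sum_comm {σ : Type*} (S : Finset σ) (A B : Finset (Finset α))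
    (h : σ → Finset α → Finset α → ℝ) :
    ∑ x ∈ A, ∑ y ∈ B, ∑ s ∈ S, h s x y = ∑ s ∈ S, ∑ x ∈ A, ∑ y ∈ B, h s x y := by
  have : ∀ x ∈ A, ∑ y ∈ B, ∑ s ∈ S, h s x y = ∑ s ∈ S, ∑ y ∈ B, h s x y := fun x _ => Finset.sum_comm
  rw [Finset.sum_congr rfl this]
  exact Finset.sum_comm

/-- `sumA` is additive over finite families of kernels. [cite: BraunEtAl2012, §3.2 proof of Thm 5
("summing up all equations", p. 12)] -/
theorem sumA_finset_sum {σ : Type*} (S : Finset σ) (X : σ → Finset α → Finset α → ℝ) :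
    sumA k (fun a b => ∑ s ∈ S, X s a b) = ∑ s ∈ S, sumA k (X s) := by
  unfold sumA
  have hT : ∀ T ∈ frames α k,
      (∑ x ∈ T.1.powersetCard (k + 1), ∑ y ∈ T.2.1.powersetCard (k + 1), ∑ s ∈ S, X s x y +
        ∑ x ∈ T.1.powersetCard k, ∑ y ∈ T.2.1.powersetCard (k + 1), ∑ s ∈ S, X s (insert T.2.2 x) y +
        ∑ x ∈ T.1.powersetCard (k + 1), ∑ y ∈ T.2.1.powersetCard k, ∑ s ∈ S, X s x (insert T.2.2 y)) =
      ∑ s ∈ S, (∑ x ∈ T.1.powersetCard (k + 1), ∑ y ∈ T.2.1.powersetCard (k + 1), X s x y +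
        ∑ x ∈ T.1.powersetCard k, ∑ y ∈ T.2.1.powersetCard (k + 1), X s (insert T.2.2 x) y +
        ∑ x ∈ T.1.powersetCard (k + 1), ∑ y ∈ T.2.1.powersetCard k, X s x (insert T.2.2 y)) := by
    intro T _
    rw [sum_sum_sum_comm S, sum_sum_sum_comm S, sum_sum_sum_comm S, ← Finset.sum_add_distrib,
      ← Finset.sum_add_distrib]
  rw [Finset.sum_congr rfl hT]
  exact Finset.sum_comm

/-- `sumB` is additive over finite families of kernels. [cite: BraunEtAl2012, §3.2 proof of Thm 5 (p. 12)] -/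
theorem sumB_finset_sum {σ : Type*} (S : Finset σ) (X : σ → Finset α → Finset α → ℝ) :
    sumB k (fun a b => ∑ s ∈ S, X s a b) = ∑ s ∈ S, sumB k (X s) := by
  unfold sumB
  have hT : ∀ T ∈ frames α k,
      ∑ x ∈ T.1.powersetCard k, ∑ y ∈ T.2.1.powersetCard k, ∑ s ∈ S, X s (insert T.2.2 x) (insert T.2.2 y) =
      ∑ s ∈ S, ∑ x ∈ T.1.powersetCard k, ∑ y ∈ T.2.1.powersetCard k, X s (insert T.2.2 x) (insert T.2.2 y) :=
    fun T _ => sum_sum_sum_comm S _ _ _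
  rw [Finset.sum_congr rfl hT]
  exact Finset.sum_comm

/-- `sumA` is monotone in the kernel. [cite: BraunEtAl2012, §3.1 (linearity of `E[· | A]`, p. 9)] -/
theorem sumA_mono {X Y : Finset α → Finset α → ℝ} (h : ∀ a b, X a b ≤ Y a b) : sumA k X ≤ sumA k Y := by
  unfold sumA
  refine Finset.sum_le_sum fun T _ => add_le_add (add_le_add ?_ ?_) ?_ <;>
    exact Finset.sum_le_sum fun x _ => Finset.sum_le_sum fun y _ => h _ _

/-- `sumB` is monotone in the kernel. [cite: BraunEtAl2012, §3.1 (linearity of `E[· | B]`, p. 9)] -/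
theorem sumB_mono {X Y : Finset α → Finset α → ℝ} (h : ∀ a b, X a b ≤ Y a b) : sumB k X ≤ sumB k Y := by
  unfold sumB
  exact Finset.sum_le_sum fun T _ => Finset.sum_le_sum fun x _ => Finset.sum_le_sum fun y _ => h _ _

/-- `sumB 1 > 0` as soon as a frame exists. [cite: BraunEtAl2012, §3.1 Step 1 (p. 9)] -/
theorem sumB_one_pos (h : (frames α k).Nonempty) : 0 < sumB (α := α) k (fun _ _ => 1) := by
  rw [sumB_one]
  have : (0 : ℝ) < (2 * k + 1).choose k := by exact_mod_cast Nat.choose_pos (by omega)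
  have hc : (0 : ℝ) < (frames α k).card := by exact_mod_cast h.card_pos
  positivity

/-- Frames exist as soon as `4k + 3 ≤ |α|`. [cite: BraunEtAl2012, §3.1 ("Suppose that `n ≡ 3 (mod 4)`
and let `ℓ = (n+1)/4`", p. 9)] -/
theorem frames_nonempty (h : 4 * k + 3 ≤ Fintype.card α) : (frames α k).Nonempty := by
  classical
  obtain ⟨T₁, -, hT₁⟩ := Finset.exists_subset_card_eq (s := (Finset.univ : Finset α))
    (show 2 * k + 1 ≤ (Finset.univ : Finset α).card by rw [Finset.card_univ]; omega)
  have hc : 2 * k + 1 ≤ (Finset.univ \ T₁).card := by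
    rw [Finset.card_sdiff_of_subset (Finset.subset_univ _), Finset.card_univ, hT₁]; omega
  obtain ⟨T₂, hT₂s, hT₂⟩ := Finset.exists_subset_card_eq hc
  have hd : Disjoint T₁ T₂ := by
    rw [Finset.disjoint_iff_ne]
    rintro a ha b hb rfl
    exact (Finset.mem_sdiff.1 (hT₂s hb)).2 ha
  have hc' : 0 < (Finset.univ \ (T₁ ∪ T₂)).card := by
    rw [Finset.card_sdiff_of_subset (Finset.subset_univ _), Finset.card_univ, Finset.card_union_of_disjoint hd,
      hT₁, hT₂]; omega
  obtain ⟨i, hi⟩ := Finset.card_pos.1 hc'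
  rw [Finset.mem_sdiff, Finset.mem_union, not_or] at hi
  exact ⟨(T₁, T₂, i), mem_frames.2 ⟨hT₁, hT₂, hd, hi.2.1, hi.2.2⟩⟩

/-! ### Step 2: the pointwise rectangle trick -/

/-- **Step 2, pointwise** ("Via obvious estimates", (3.15) p. 10, applied to each of the three disjoint
kinds): for non-negative reals,
`R₀C₀ + R₁C₀ + R₀C₁ − 3 R₁C₁ ≤ 3 (R₀ |C₀ − C₁| + |R₀ − R₁| C₀)`, since each `R_u C_w − R₁ C₁ ≤
R_u C_w − min R · min C ≤ R₀|C₀ − C₁| + |R₀ − R₁| C₀`. [cite: BraunEtAl2012, §3.1 Step 2 (3.15) (p. 10)] -/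
theorem step_two {r₀ r₁ c₀ c₁ : ℝ} (hr₀ : 0 ≤ r₀) (hr₁ : 0 ≤ r₁) (hc₀ : 0 ≤ c₀) (hc₁ : 0 ≤ c₁) :
    r₀ * c₀ + r₁ * c₀ + r₀ * c₁ - 3 * (r₁ * c₁) ≤ 3 * (r₀ * |c₀ - c₁| + |r₀ - r₁| * c₀) := by
  set r := min r₀ r₁ with hr
  set c := min c₀ c₁ with hc
  have hrr₀ : r ≤ r₀ := min_le_left _ _
  have hrr₁ : r ≤ r₁ := min_le_right _ _
  have hcc₀ : c ≤ c₀ := min_le_left _ _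
  have hcc₁ : c ≤ c₁ := min_le_right _ _
  have hr0 : 0 ≤ r := le_min hr₀ hr₁
  have hc0 : 0 ≤ c := le_min hc₀ hc₁
  have hdr₀ : r₀ - r ≤ |r₀ - r₁| := by
    rcases le_total r₀ r₁ with h | h
    · rw [hr, min_eq_left h, sub_self]; exact abs_nonneg _
    · rw [hr, min_eq_right h]; exact le_abs_self _
  have hdr₁ : r₁ - r ≤ |r₀ - r₁| := by
    rcases le_total r₀ r₁ with h | h
    · rw [hr, min_eq_left h, abs_sub_comm]; exact le_abs_self _
    · rw [hr, min_eq_right h, sub_self]; exact abs_nonneg _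
  have hdc₀ : c₀ - c ≤ |c₀ - c₁| := by
    rcases le_total c₀ c₁ with h | h
    · rw [hc, min_eq_left h, sub_self]; exact abs_nonneg _
    · rw [hc, min_eq_right h]; exact le_abs_self _
  have hdc₁ : c₁ - c ≤ |c₀ - c₁| := by
    rcases le_total c₀ c₁ with h | h
    · rw [hc, min_eq_left h, abs_sub_comm]; exact le_abs_self _
    · rw [hc, min_eq_right h, sub_self]; exact abs_nonneg _
  have hrc : r * c ≤ r₁ * c₁ := mul_le_mul hrr₁ hcc₁ hc0 hr₁
  -- the three kinds
  have h00 : r₀ * c₀ - r₁ * c₁ ≤ r₀ * |c₀ - c₁| + |r₀ - r₁| * c₀ := by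
    have e : r₀ * c₀ - r * c = (r₀ - r) * c₀ + r * (c₀ - c) := by ring
    nlinarith [mul_le_mul_of_nonneg_right hdr₀ hc₀, mul_le_mul_of_nonneg_left hdc₀ hr0,
      mul_le_mul_of_nonneg_right hrr₀ (abs_nonneg (c₀ - c₁))]
  have h10 : r₁ * c₀ - r₁ * c₁ ≤ r₀ * |c₀ - c₁| + |r₀ - r₁| * c₀ := by
    have e : r₁ * c₀ - r * c = (r₁ - r) * c₀ + r * (c₀ - c) := by ring
    nlinarith [mul_le_mul_of_nonneg_right hdr₁ hc₀, mul_le_mul_of_nonneg_left hdc₀ hr0,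
      mul_le_mul_of_nonneg_right hrr₀ (abs_nonneg (c₀ - c₁))]
  have h01 : r₀ * c₁ - r₁ * c₁ ≤ r₀ * |c₀ - c₁| + |r₀ - r₁| * c₀ := by
    have e : r₀ * c₁ - r * c = r₀ * (c₁ - c) + (r₀ - r) * c := by ring
    nlinarith [mul_le_mul_of_nonneg_left hdc₁ hr₀, mul_le_mul_of_nonneg_right hdr₀ hc0,
      mul_le_mul_of_nonneg_left hcc₀ (abs_nonneg (r₀ - r₁))]
  linarith

/-! ### The two re-indexings of the frame sum -/

/-- **Grouping the frames by their window** `(T₁ ∪ {i}, T₂)`: a frame is a window together with a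
pivot `i ∈ W` (`T₁ = W ∖ {i}`), bijectively ("Pick a `(2ℓ−1)`-subset `T₂` … fixing `T₂` does not fix `i`,
which could be any element of `[n] ∖ T₂`", p. 10). [cite: BraunEtAl2012, §3.1 Step 1 (p. 10)] -/
theorem sum_frames_eq_sum_windows (k : ℕ) (Φ : Finset α × Finset α × α → ℝ) :
    ∑ T ∈ frames α k, Φ T = ∑ P ∈ windows α k, ∑ i ∈ P.1, Φ (P.1.erase i, P.2, i) := by
  rw [Finset.sum_sigma']
  symm
  refine Finset.sum_nbij' (fun q => (q.1.1.erase q.2, q.1.2, q.2))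
    (fun T => ⟨(insert T.2.2 T.1, T.2.1), T.2.2⟩) ?_ ?_ ?_ ?_ fun _ _ => rfl
  · rintro ⟨⟨W, T₂⟩, i⟩ hq
    rw [Finset.mem_sigma] at hq
    rcases hq with ⟨hP, hi⟩
    rcases mem_windows.1 hP with ⟨h1, h2, h3⟩
    refine mem_frames.2 ⟨?_, h2, h3.mono_left (Finset.erase_subset _ _), Finset.notMem_erase i W,
      Finset.disjoint_left.1 h3 hi⟩
    change (W.erase i).card = 2 * k + 1
    rw [Finset.card_erase_of_mem hi, h1]; rfl
  · rintro ⟨T₁, T₂, i⟩ hT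
    rcases mem_frames.1 hT with ⟨h1, h2, h3, h4, h5⟩
    rw [Finset.mem_sigma]
    refine ⟨mem_windows.2 ⟨?_, h2, Finset.disjoint_insert_left.2 ⟨h5, h3⟩⟩, Finset.mem_insert_self _ _⟩
    change (insert i T₁).card = 2 * k + 2
    rw [Finset.card_insert_of_notMem h4, h1]
  · rintro ⟨⟨W, T₂⟩, i⟩ hq
    rw [Finset.mem_sigma] at hq
    change (⟨(insert i (W.erase i), T₂), i⟩ : (_ : Finset α × Finset α) × α) = ⟨(W, T₂), i⟩
    rw [Finset.insert_erase hq.2]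
  · rintro ⟨T₁, T₂, i⟩ hT
    rcases mem_frames.1 hT with ⟨-, -, -, h4, -⟩
    change ((insert i T₁).erase i, T₂, i) = (T₁, T₂, i)
    rw [Finset.erase_insert h4]

/-- **Exchanging rows and columns**: the frame sum is invariant under `swap`.
[cite: BraunEtAl2012, §3.1 ("Exchanging the roles of rows and columns", p. 10)] -/
theorem sum_frames_swap (k : ℕ) (Φ : Finset α × Finset α × α → ℝ) :
    ∑ T ∈ frames α k, Φ (swap T) = ∑ T ∈ frames α k, Φ T :=
  Finset.sum_nbij' swap swap (fun _ hT => swap_mem_frames hT) (fun _ hT => swap_mem_frames hT)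
    (fun T _ => swap_swap T) (fun T _ => swap_swap T) fun _ _ => rfl

omit [Fintype α] in
/-- Splitting a window slice by the pivot: `C(W, ℓ) = C(W ∖ {i}, ℓ) ⊔ {x ∪ {i} : x ∈ C(W ∖ {i}, ℓ−1)}`.
[cite: BraunEtAl2012, §3.1 Step 1 ((3.5): `E[f | T] = (Row₀ + Row₁)/2`, p. 9)] -/
theorem sum_powersetCard_window {W : Finset α} {i : α} (hi : i ∈ W) (φ : Finset α → ℝ) :
    ∑ x ∈ W.powersetCard (k + 1), φ x =
      ∑ x ∈ (W.erase i).powersetCard (k + 1), φ x + ∑ x ∈ (W.erase i).powersetCard k, φ (insert i x) := by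
  have hsplit := Finset.powersetCard_succ_insert (Finset.notMem_erase i W) k
  rw [Finset.insert_erase hi] at hsplit
  rw [hsplit, Finset.sum_union, Finset.sum_image]
  · intro x hx y hy hxy
    have hx' : i ∉ x := fun h => Finset.notMem_erase i W ((Finset.mem_powersetCard.1 hx).1 h)
    have hy' : i ∉ y := fun h => Finset.notMem_erase i W ((Finset.mem_powersetCard.1 hy).1 h)
    rw [← Finset.erase_insert hx', hxy, Finset.erase_insert hy']
  · rw [Finset.disjoint_left]
    intro x hx hx'
    obtain ⟨y, -, rfl⟩ := Finset.mem_image.1 hx'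
    exact Finset.notMem_erase i W ((Finset.mem_powersetCard.1 hx).1 (Finset.mem_insert_self i y))

omit [Fintype α] in
/-- `Row₀ + Row₁ = ` the window sum ((3.5): "`E[f(a) | T] = (Row₀(T) + Row₁(T))/2`").
[cite: BraunEtAl2012, §3.1 (3.5) (p. 9)] -/
theorem lo_add_hi {W T₂ : Finset α} {i : α} (hiW : i ∈ W) (f : Finset α → ℝ) :
    lo k f (W.erase i, T₂, i) + hi k f (W.erase i, T₂, i) = full k f W := by
  unfold lo hi full
  exact (sum_powersetCard_window hiW f).symm

omit [Fintype α] in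
/-- `Row₀ − Row₁ = Σ_{x ∈ C(W, ℓ)} f(x) χ_i(x)` — the un-normalised singleton Fourier coefficient of the
tilted measure ((3.22)–(3.23): `Row₁ = 2λ E[f]`, `Row₀ = 2(1−λ) E[f]`). [cite: BraunEtAl2012, §3.1 Step 3
(3.22)–(3.23) (p. 11)] -/
theorem lo_sub_hi {W T₂ : Finset α} {i : α} (hiW : i ∈ W) (f : Finset α → ℝ) :
    lo k f (W.erase i, T₂, i) - hi k f (W.erase i, T₂, i) = ∑ x ∈ W.powersetCard (k + 1), f x * chi i x := by
  rw [sum_powersetCard_window hiW]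
  unfold lo hi
  have h1 : ∀ x ∈ (W.erase i).powersetCard (k + 1), f x * chi i x = f x := by
    intro x hx
    have : i ∉ x := fun h => Finset.notMem_erase i W ((Finset.mem_powersetCard.1 hx).1 h)
    simp [chi, this]
  have h2 : ∀ x ∈ (W.erase i).powersetCard k, f (insert i x) * chi i (insert i x) = -f (insert i x) := by
    intro x _
    simp [chi]
  rw [Finset.sum_congr rfl h1, Finset.sum_congr rfl h2, Finset.sum_neg_distrib]
  ring


/-- `Row₀ + Row₁` on a frame is the window sum over `T₁ ∪ {i}`. [cite: BraunEtAl2012, §3.1 (3.5) (p. 9)] -/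
theorem lo_add_hi_frame {T : Finset α × Finset α × α} (hT : T ∈ frames α k) (f : Finset α → ℝ) :
    lo k f T + hi k f T = full k f (insert T.2.2 T.1) := by
  rcases mem_frames.1 hT with ⟨-, -, -, h4, -⟩
  have := lo_add_hi (k := k) (T₂ := T.2.1) (Finset.mem_insert_self T.2.2 T.1) f
  rwa [Finset.erase_insert h4] at this

/-! ### Step 3: the level-one (entropy) estimate on a window, via Chang's inequality -/

/-- An enumeration of the window `W` by `Fin |W|` (to transport set functions on `2^W` to the cube
`{0,1}^{|W|}` of `ChangInequalityDensities`). [cite: BraunEtAl2012, §3.1 Step 3 (p. 11, "`j ∈ [n] ∖ T₂`")] -/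
def finEquiv (W : Finset α) : Fin W.card ≃ {a // a ∈ W} :=
  (Fintype.equivFinOfCardEq (Fintype.card_coe W)).symm

/-- The subset of `W` encoded by a bit vector. [cite: BraunEtAl2012, §3.1 Step 3 (p. 11, the indicators
`I_{j ∈ s}`)] -/
def bitsToSet (W : Finset α) (z : Fin W.card → Bool) : Finset α :=
  (Finset.univ.filter fun j => z j = true).map
    ((finEquiv W).toEmbedding.trans (Function.Embedding.subtype _))

/-- The bit vector of a subset of `W`. [cite: BraunEtAl2012, §3.1 Step 3 (p. 11)] -/
def setToBits (W : Finset α) (x : Finset α) : Fin W.card → Bool :=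
  fun j => decide (((finEquiv W j : {a // a ∈ W}) : α) ∈ x)

omit [DecidableEq α] [Fintype α] in
/-- Membership of an enumerated point in the encoded set. [cite: BraunEtAl2012, §3.1 Step 3 (p. 11)] -/
theorem coe_mem_bitsToSet {W : Finset α} {z : Fin W.card → Bool} {j : Fin W.card} :
    ((finEquiv W j : {a // a ∈ W}) : α) ∈ bitsToSet W z ↔ z j = true := by
  unfold bitsToSet
  rw [Finset.mem_map]
  constructor
  · rintro ⟨j', hj', hjj'⟩
    have : j' = j := by
      have h1 : (finEquiv W j' : {a // a ∈ W}) = finEquiv W j := Subtype.ext (by simpa using hjj')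
      exact (finEquiv W).injective h1
    subst this
    exact (Finset.mem_filter.1 hj').2
  · intro hz
    exact ⟨j, Finset.mem_filter.2 ⟨Finset.mem_univ _, hz⟩, rfl⟩

omit [DecidableEq α] [Fintype α] in
/-- Encoded sets are subsets of the window. [cite: BraunEtAl2012, §3.1 Step 3 (p. 11)] -/
theorem bitsToSet_subset (W : Finset α) (z : Fin W.card → Bool) : bitsToSet W z ⊆ W := by
  intro a ha
  unfold bitsToSet at ha
  obtain ⟨j, -, rfl⟩ := Finset.mem_map.1 ha
  exact (finEquiv W j).2

omit [DecidableEq α] [Fintype α] in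
/-- Membership of a window point in the encoded set. [cite: BraunEtAl2012, §3.1 Step 3 (p. 11)] -/
theorem mem_bitsToSet {W : Finset α} {z : Fin W.card → Bool} {a : α} (ha : a ∈ W) :
    a ∈ bitsToSet W z ↔ z ((finEquiv W).symm ⟨a, ha⟩) = true := by
  have := coe_mem_bitsToSet (W := W) (z := z) (j := (finEquiv W).symm ⟨a, ha⟩)
  rwa [Equiv.apply_symm_apply] at this

omit [Fintype α] in
/-- **Re-indexing `2^W` by the cube `{0,1}^{|W|}`.** [cite: BraunEtAl2012, §3.1 Step 3 (p. 11, `s` as a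
random subset / as indicator bits)] -/
theorem sum_bitsToSet (W : Finset α) (ψ : Finset α → ℝ) :
    ∑ z : Fin W.card → Bool, ψ (bitsToSet W z) = ∑ x ∈ W.powerset, ψ x := by
  refine Finset.sum_nbij' (bitsToSet W) (setToBits W) (fun z _ => Finset.mem_powerset.2 (bitsToSet_subset W z))
    (fun _ _ => Finset.mem_univ _) (fun z _ => ?_) (fun x hx => ?_) fun _ _ => rfl
  · funext j
    simp [setToBits, coe_mem_bitsToSet]
  · have hxW : x ⊆ W := Finset.mem_powerset.1 hx
    ext a
    constructor
    · intro ha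
      have haW : a ∈ W := bitsToSet_subset W _ ha
      have := (mem_bitsToSet haW).1 ha
      simpa [setToBits] using this
    · intro ha
      have haW : a ∈ W := hxW ha
      exact (mem_bitsToSet haW).2 (by simpa [setToBits] using ha)

omit [Fintype α] in
/-- **The level-one inequality for flat measures on `2^W` (entropy form of Chang's lemma).**  If
`φ ≥ 0` on `2^W` has `φ(x) · 2^{|W|} ≤ K · Σ φ` for all `x ⊆ W` (density at most `K` w.r.t. the uniform
measure), then `Σ_{a ∈ W} (Σ_{x ⊆ W} φ(x) χ_a(x))² ≤ 2 log K · (Σ φ)²` — the printed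
(3.19)–(3.27) ("`H[s] ≤ Σ_j H[I_{j∈s}] = 2ℓ E[H(λ)]`", flatness "`H[s] ≥ log(C(2ℓ,ℓ)/2^{δℓ+1})`",
"`1 − H(x) ≥ (1−2x)²/(2 ln 2)`"), here imported from the tree's
`Literature.Probability.Moments.sum_sq_cubeFourierCoeff_le_of_isTriangular` (Impagliazzo–Moore–Russell)
applied to the singletons. [cite: BraunEtAl2012, §3.1 Step 3 (3.19)–(3.27) (p. 11)]
[cite: ImpagliazzoMooreRussell2014, Lemma 1] -/
theorem level_one (W : Finset α) (φ : Finset α → ℝ) (hφ : ∀ x, 0 ≤ φ x) {K : ℝ}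
    (hK : ∀ x ∈ W.powerset, φ x * 2 ^ W.card ≤ K * ∑ y ∈ W.powerset, φ y) :
    ∑ a ∈ W, (∑ x ∈ W.powerset, φ x * chi a x) ^ 2 ≤
      2 * Real.log K * (∑ y ∈ W.powerset, φ y) ^ 2 := by
  set F := ∑ y ∈ W.powerset, φ y with hF
  have hF0 : 0 ≤ F := Finset.sum_nonneg fun x _ => hφ x
  rcases hF0.eq_or_lt with hF0' | hFpos
  · -- `F = 0`: `φ` vanishes on `2^W`
    have hz : ∀ x ∈ W.powerset, φ x = 0 := fun x hx =>
      (Finset.sum_eq_zero_iff_of_nonneg (fun y _ => hφ y)).1 hF0'.symm x hx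
    have : ∀ a ∈ W, (∑ x ∈ W.powerset, φ x * chi a x) ^ 2 = 0 := by
      intro a _
      rw [Finset.sum_eq_zero (fun x hx => by rw [hz x hx, zero_mul]), zero_pow two_ne_zero]
    rw [Finset.sum_congr rfl this, Finset.sum_const_zero, ← hF0']
    simp
  · set m := W.card with hm
    set q : (Fin m → Bool) → ℝ := fun z => 2 ^ m * φ (bitsToSet W z) / F with hq
    have hq0 : ∀ z, 0 ≤ q z := fun z => div_nonneg (mul_nonneg (by positivity) (hφ _)) hF0
    have hq1 : ∑ z, q z = 2 ^ m := by
      simp only [hq]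
      rw [← Finset.sum_div, ← Finset.mul_sum, sum_bitsToSet, ← hF]
      field_simp
    have hqK : ∀ z, q z ≤ K := by
      intro z
      simp only [hq]
      rw [div_le_iff₀ hFpos, mul_comm]
      exact hK _ (Finset.mem_powerset.2 (bitsToSet_subset W z))
    have htri : Literature.Probability.Moments.IsTriangular
        ((List.finRange m).map fun j => (({j} : Finset (Fin m)), j)) := by
      refine ⟨fun e he => ?_, ?_⟩
      · obtain ⟨j, -, rfl⟩ := List.mem_map.1 he
        exact Finset.mem_singleton_self _
      · rw [List.pairwise_map]
        exact List.Pairwise.imp (fun {a b} (hab : a ≠ b) => by simpa using hab) (List.nodup_finRange m)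
    have hchang := Literature.Probability.Moments.sum_sq_cubeFourierCoeff_le_of_isTriangular hq0 hq1 hqK htri
    rw [List.map_map] at hchang
    have hsum : ((List.finRange m).map ((fun e : Finset (Fin m) × Fin m => LowDegree.cubeFourierCoeff q e.1 ^ 2) ∘
        fun j => (({j} : Finset (Fin m)), j))).sum = ∑ j : Fin m, LowDegree.cubeFourierCoeff q {j} ^ 2 := by
      rw [← List.ofFn_eq_map, List.sum_ofFn]
      rfl
    rw [hsum] at hchang
    -- the singleton coefficients are the normalised signed window sums
    have hcoef : ∀ j : Fin m, LowDegree.cubeFourierCoeff q {j} =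
        (∑ x ∈ W.powerset, φ x * chi ((finEquiv W j : {a // a ∈ W}) : α) x) / F := by
      intro j
      unfold LowDegree.cubeFourierCoeff
      have hterm : ∀ z : Fin m → Bool, q z * Literature.Probability.RandomGraphs.LowDegree.walsh {j} z =
          2 ^ m / F * (φ (bitsToSet W z) * chi ((finEquiv W j : {a // a ∈ W}) : α) (bitsToSet W z)) := by
        intro z
        have hchi : Literature.Probability.RandomGraphs.LowDegree.walsh {j} z =
            chi ((finEquiv W j : {a // a ∈ W}) : α) (bitsToSet W z) := by
          unfold Literature.Probability.RandomGraphs.LowDegree.walsh chi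
          rw [Finset.prod_singleton]
          by_cases hz : z j = true
          · rw [if_pos (coe_mem_bitsToSet.2 hz), hz, Literature.Probability.RandomGraphs.LowDegree.sgn_true]
          · rw [if_neg (mt coe_mem_bitsToSet.1 hz)]
            rw [Bool.not_eq_true] at hz
            rw [hz, Literature.Probability.RandomGraphs.LowDegree.sgn_false]
        rw [hchi, hq]
        ring
      rw [Finset.sum_congr rfl fun z _ => hterm z, ← Finset.mul_sum,
        sum_bitsToSet W (fun x => φ x * chi ((finEquiv W j : {a // a ∈ W}) : α) x)]
      field_simp
    have hre : ∑ j : Fin m, LowDegree.cubeFourierCoeff q {j} ^ 2 =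
        (∑ a ∈ W, (∑ x ∈ W.powerset, φ x * chi a x) ^ 2) / F ^ 2 := by
      simp_rw [hcoef, div_pow]
      rw [← Finset.sum_div]
      congr 1
      rw [← Finset.sum_coe_sort W]
      exact Fintype.sum_equiv (finEquiv W) _ _ fun j => rfl
    rw [hre, div_le_iff₀ (by positivity)] at hchang
    exact hchang

/-- The event `E_big(W)` for `f` ("`E[f(a) | T₂] > 2^{−δℓ−1} ‖f|_W‖_∞`", p. 10): every value of `f` on
the slice `C(W, ℓ)` is at most `e^κ` times its average. [cite: BraunEtAl2012, §3.1 Step 3 (p. 10,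
definition of `E_{row-big}(T)`)] -/
def Big (k : ℕ) (f : Finset α → ℝ) (κ : ℝ) (W : Finset α) : Prop :=
  ∀ x ∈ W.powersetCard (k + 1), f x * ((2 * k + 2).choose (k + 1) : ℝ) ≤ Real.exp κ * full k f W

/-- `4^ℓ ≤ 2ℓ · C(2ℓ, ℓ)` in the form `2^{2k+2} ≤ (2k+2) · C(2k+2, k+1)` (Mathlib's Erdős bound; the printed
"`log C(2ℓ, ℓ) = 2ℓ (1 − O(log ℓ / ℓ))`", (3.21)). [cite: BraunEtAl2012, §3.1 Step 3 (3.21) (p. 11)] -/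
theorem two_pow_le_mul_choose (k : ℕ) :
    (2 : ℝ) ^ (2 * k + 2) ≤ (2 * k + 2) * ((2 * k + 2).choose (k + 1) : ℝ) := by
  have h := Nat.four_pow_le_two_mul_self_mul_centralBinom (k + 1) (Nat.succ_pos k)
  rw [Nat.centralBinom_eq_two_mul_choose, show 2 * (k + 1) = 2 * k + 2 by ring] at h
  have h' : (4 : ℝ) ^ (k + 1) ≤ ((2 * k + 2 : ℕ) : ℝ) * ((2 * k + 2).choose (k + 1) : ℝ) := by
    exact_mod_cast h
  have e1 : (2 : ℝ) ^ (2 * k + 2) = 4 ^ (k + 1) := by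
    rw [show (4 : ℝ) = 2 ^ 2 by norm_num, ← pow_mul, show 2 * (k + 1) = 2 * k + 2 by ring]
  calc (2 : ℝ) ^ (2 * k + 2) = 4 ^ (k + 1) := e1
    _ ≤ ((2 * k + 2 : ℕ) : ℝ) * ((2 * k + 2).choose (k + 1) : ℝ) := h'
    _ = (2 * k + 2) * ((2 * k + 2).choose (k + 1) : ℝ) := by push_cast; ring

omit [Fintype α] in
/-- **Step 3 on a window** ((3.28)–(3.29) summed over the pivot, with Cauchy–Schwarz (3.27)): if `E_big`
holds for `f` on `W` (`|W| = 2ℓ`) with flatness parameter `e^κ`, then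
`Σ_{i ∈ W} |Row₀ − Row₁| ≤ √(2ℓ · 2(κ + log 2ℓ)) · Σ_{C(W,ℓ)} f`. [cite: BraunEtAl2012, §3.1 Step 3
(3.27)–(3.29) (p. 11)] -/
theorem sum_abs_lo_sub_hi_le {W T₂ : Finset α} (hW : W.card = 2 * k + 2) (f : Finset α → ℝ)
    (hf : ∀ x, 0 ≤ f x) {κ : ℝ} (hbig : Big k f κ W) :
    ∑ i ∈ W, |lo k f (W.erase i, T₂, i) - hi k f (W.erase i, T₂, i)| ≤
      Real.sqrt ((2 * k + 2) * (2 * (κ + Real.log (2 * k + 2)))) * full k f W := by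
  set φ : Finset α → ℝ := fun x => if x.card = k + 1 then f x else 0 with hφ
  have hφ0 : ∀ x, 0 ≤ φ x := fun x => by simp only [hφ]; split_ifs; exacts [hf x, le_rfl]
  have hφsum : ∀ ψ : Finset α → ℝ, ∑ x ∈ W.powerset, φ x * ψ x = ∑ x ∈ W.powersetCard (k + 1), f x * ψ x := by
    intro ψ
    rw [Finset.powersetCard_eq_filter, Finset.sum_filter]
    refine Finset.sum_congr rfl fun x _ => ?_
    simp only [hφ]
    split_ifs <;> simp
  have hF : ∑ y ∈ W.powerset, φ y = full k f W := by
    have := hφsum fun _ => 1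
    simpa [full] using this
  have hFnn : 0 ≤ full k f W := Finset.sum_nonneg fun x _ => hf x
  have hflat : ∀ x ∈ W.powerset, φ x * 2 ^ W.card ≤ (Real.exp κ * (2 * k + 2)) * ∑ y ∈ W.powerset, φ y := by
    intro x hx
    rw [hF, hW]
    simp only [hφ]
    split_ifs with hxc
    · calc f x * 2 ^ (2 * k + 2) ≤ f x * ((2 * k + 2) * ((2 * k + 2).choose (k + 1) : ℝ)) :=
            mul_le_mul_of_nonneg_left (two_pow_le_mul_choose k) (hf x)
        _ = (2 * k + 2) * (f x * ((2 * k + 2).choose (k + 1) : ℝ)) := by ring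
        _ ≤ (2 * k + 2) * (Real.exp κ * full k f W) :=
            mul_le_mul_of_nonneg_left (hbig x (Finset.mem_powersetCard.2 ⟨Finset.mem_powerset.1 hx, hxc⟩))
              (by positivity)
        _ = Real.exp κ * (2 * k + 2) * full k f W := by ring
    · rw [zero_mul]
      positivity
  have hlev := level_one W φ hφ0 hflat
  rw [Real.log_mul (Real.exp_pos κ).ne' (by positivity), Real.log_exp, hF] at hlev
  have hlev' : ∑ a ∈ W, (∑ x ∈ W.powersetCard (k + 1), f x * chi a x) ^ 2 ≤
      2 * (κ + Real.log (2 * k + 2)) * full k f W ^ 2 := by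
    have : ∀ a ∈ W, (∑ x ∈ W.powerset, φ x * chi a x) ^ 2 = (∑ x ∈ W.powersetCard (k + 1), f x * chi a x) ^ 2 :=
      fun a _ => by rw [hφsum]
    rw [Finset.sum_congr rfl this] at hlev
    convert hlev using 2
  -- Cauchy–Schwarz
  set V : α → ℝ := fun a => ∑ x ∈ W.powersetCard (k + 1), f x * chi a x with hV
  have hcs := Finset.sum_mul_sq_le_sq_mul_sq W (fun _ => (1 : ℝ)) (fun a => |V a|)
  simp only [one_mul, one_pow, Finset.sum_const, nsmul_eq_mul, mul_one, sq_abs] at hcs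
  rw [hW] at hcs
  have heq : ∀ i ∈ W, |lo k f (W.erase i, T₂, i) - hi k f (W.erase i, T₂, i)| = |V i| :=
    fun i hi => by rw [lo_sub_hi hi]
  rw [Finset.sum_congr rfl heq]
  have hlhs : 0 ≤ ∑ i ∈ W, |V i| := Finset.sum_nonneg fun i _ => abs_nonneg _
  rcases hFnn.eq_or_lt with h0 | hpos
  · -- `Σ_{C(W,ℓ)} f = 0`: every `V i` vanishes
    have hz : ∀ x ∈ W.powersetCard (k + 1), f x = 0 := fun x hx =>
      (Finset.sum_eq_zero_iff_of_nonneg (fun y _ => hf y)).1 h0.symm x hx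
    have hV0 : ∀ a ∈ W, |V a| = 0 := by
      intro a _
      rw [abs_eq_zero, hV]
      exact Finset.sum_eq_zero fun x hx => by rw [hz x hx, zero_mul]
    rw [Finset.sum_eq_zero hV0, ← h0, mul_zero]
  · have hc : 0 ≤ 2 * (κ + Real.log (2 * k + 2)) := by
      have h1 : (0 : ℝ) ≤ ∑ a ∈ W, V a ^ 2 := Finset.sum_nonneg fun a _ => sq_nonneg _
      have h2 : 0 ≤ 2 * (κ + Real.log (2 * k + 2)) * full k f W ^ 2 := h1.trans hlev'
      exact (mul_nonneg_iff_of_pos_right (by positivity)).1 h2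
    have hnn : 0 ≤ (2 * k + 2 : ℝ) * (2 * (κ + Real.log (2 * k + 2))) := by positivity
    have hsq : (∑ i ∈ W, |V i|) ^ 2 ≤
        (Real.sqrt ((2 * k + 2) * (2 * (κ + Real.log (2 * k + 2)))) * full k f W) ^ 2 := by
      calc (∑ i ∈ W, |V i|) ^ 2 ≤ (2 * k + 2 : ℝ) * ∑ i ∈ W, V i ^ 2 := by
            have e : ((2 * k + 2 : ℕ) : ℝ) = 2 * k + 2 := by push_cast; ring
            rw [e] at hcs
            exact hcs
        _ ≤ (2 * k + 2 : ℝ) * (2 * (κ + Real.log (2 * k + 2)) * full k f W ^ 2) :=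
            mul_le_mul_of_nonneg_left hlev' (by positivity)
        _ = (Real.sqrt ((2 * k + 2) * (2 * (κ + Real.log (2 * k + 2)))) * full k f W) ^ 2 := by
            rw [mul_pow, Real.sq_sqrt hnn]; ring
    have hrhs : 0 ≤ Real.sqrt ((2 * k + 2) * (2 * (κ + Real.log (2 * k + 2)))) * full k f W :=
      mul_nonneg (Real.sqrt_nonneg _) hFnn
    exact (pow_le_pow_iff_left₀ hlhs hrhs two_ne_zero).1 hsq


/-! ### Steps 3 and 4 per frame, and the assembly -/

open Classical in
/-- The indicator of the event `E_big` ((3.16): "`1 = I_{E_rowbig ∩ E_colbig} + I_{E_small}`").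
[cite: BraunEtAl2012, §3.1 Step 2 (3.16) (p. 10)] -/
def bigInd (k : ℕ) (f : Finset α → ℝ) (κ : ℝ) (W : Finset α) : ℝ := if Big k f κ W then 1 else 0

omit [DecidableEq α] [Fintype α] in
/-- `I_{E_big} = 1` on the event. [cite: BraunEtAl2012, §3.1 (3.16) (p. 10)] -/
theorem bigInd_of_big {f : Finset α → ℝ} {κ : ℝ} {W : Finset α} (h : Big k f κ W) : bigInd k f κ W = 1 := by
  simp [bigInd, h]

omit [DecidableEq α] [Fintype α] in
/-- `I_{E_big} = 0` off the event. [cite: BraunEtAl2012, §3.1 (3.16) (p. 10)] -/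
theorem bigInd_of_not_big {f : Finset α → ℝ} {κ : ℝ} {W : Finset α} (h : ¬ Big k f κ W) :
    bigInd k f κ W = 0 := by
  simp [bigInd, h]

omit [DecidableEq α] [Fintype α] in
/-- `0 ≤ I_{E_big}`. [cite: BraunEtAl2012, §3.1 (3.16) (p. 10)] -/
theorem bigInd_nonneg (f : Finset α → ℝ) (κ : ℝ) (W : Finset α) : 0 ≤ bigInd k f κ W := by
  unfold bigInd; split_ifs <;> norm_num

/-- **Step 3 globalised** ((3.29)–(3.30): "`E[|Row₀ − Row₁| Col₀ I_{E_rowbig}] ≤ 2√δ' E[Row₀ Col₀]`",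
here with `E[f | T₂] = (Row₀ + Row₁)/2` in place of `E[Row₀ | T₂]`): for `H ≥ 0` depending on `T₂` only,
`Σ_T I_{E_big(T₁ ∪ {i})} |Row₀ − Row₁| H(T₂) ≤ (√(2ℓ·2(κ + log 2ℓ))/2ℓ) Σ_T (Row₀ + Row₁) H(T₂)`.
[cite: BraunEtAl2012, §3.1 Step 3 (3.29)–(3.30) (p. 11)] -/
theorem rowBig (f : Finset α → ℝ) (hf : ∀ x, 0 ≤ f x) (H : Finset α → ℝ) (hH : ∀ S, 0 ≤ H S) (κ : ℝ) :
    ∑ T ∈ frames α k, bigInd k f κ (insert T.2.2 T.1) * (|lo k f T - hi k f T| * H T.2.1) ≤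
      Real.sqrt ((2 * k + 2) * (2 * (κ + Real.log (2 * k + 2)))) / (2 * k + 2) *
        ∑ T ∈ frames α k, (lo k f T + hi k f T) * H T.2.1 := by
  set s := Real.sqrt ((2 * k + 2) * (2 * (κ + Real.log (2 * k + 2)))) with hs
  rw [sum_frames_eq_sum_windows k (fun T => bigInd k f κ (insert T.2.2 T.1) * (|lo k f T - hi k f T| * H T.2.1)),
    sum_frames_eq_sum_windows k (fun T => (lo k f T + hi k f T) * H T.2.1), Finset.mul_sum]
  refine Finset.sum_le_sum fun P hP => ?_
  rcases mem_windows.1 hP with ⟨hW, -, -⟩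
  dsimp only
  have hrhs : ∑ i ∈ P.1, (lo k f (P.1.erase i, P.2, i) + hi k f (P.1.erase i, P.2, i)) * H P.2 =
      (2 * k + 2) * (full k f P.1 * H P.2) := by
    rw [Finset.sum_congr rfl fun i hi => by rw [lo_add_hi hi], Finset.sum_const, hW, nsmul_eq_mul]
    push_cast
    ring
  rw [hrhs]
  have hfull : 0 ≤ full k f P.1 := Finset.sum_nonneg fun x _ => hf x
  have hs0 : 0 ≤ s := Real.sqrt_nonneg _
  by_cases hB : Big k f κ P.1
  · have hlhs : ∑ i ∈ P.1, bigInd k f κ (insert i (P.1.erase i)) *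
        (|lo k f (P.1.erase i, P.2, i) - hi k f (P.1.erase i, P.2, i)| * H P.2) =
        (∑ i ∈ P.1, |lo k f (P.1.erase i, P.2, i) - hi k f (P.1.erase i, P.2, i)|) * H P.2 := by
      rw [Finset.sum_mul]
      refine Finset.sum_congr rfl fun i hi => ?_
      rw [Finset.insert_erase hi, bigInd_of_big hB, one_mul]
    rw [hlhs]
    have h3 := sum_abs_lo_sub_hi_le (T₂ := P.2) hW f hf hB
    have h22 : (0 : ℝ) < 2 * k + 2 := by positivity
    calc (∑ i ∈ P.1, |lo k f (P.1.erase i, P.2, i) - hi k f (P.1.erase i, P.2, i)|) * H P.2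
        ≤ (s * full k f P.1) * H P.2 := mul_le_mul_of_nonneg_right h3 (hH _)
      _ = s / (2 * k + 2) * ((2 * k + 2) * (full k f P.1 * H P.2)) := by
          field_simp
  · have hlhs : ∑ i ∈ P.1, bigInd k f κ (insert i (P.1.erase i)) *
        (|lo k f (P.1.erase i, P.2, i) - hi k f (P.1.erase i, P.2, i)| * H P.2) = 0 := by
      refine Finset.sum_eq_zero fun i hi => ?_
      rw [Finset.insert_erase hi, bigInd_of_not_big hB, zero_mul]
    rw [hlhs]
    have := hH P.2
    positivity

omit [Fintype α] in
/-- `N ≥ 0` under the max-norm hypothesis (take `a = b = ∅`). [cite: BraunEtAl2012, §3.1 Lemma 4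
(`‖X|_{A ∪ B}‖_∞`, p. 9)] -/
theorem nonneg_of_maxNorm {f g : Finset α → ℝ} (hf : ∀ x, 0 ≤ f x) (hg : ∀ x, 0 ≤ g x) {N : ℝ}
    (hN : ∀ a b : Finset α, (a ∩ b).card ≤ 1 → f a * g b ≤ N) : 0 ≤ N :=
  (mul_nonneg (hf ∅) (hg ∅)).trans (hN ∅ ∅ (by simp))

/-- **Step 4 (the "small" case)** ((3.31)–(3.33)): if `E_big` fails for `f` on `T₁ ∪ {i}`, then
`Row₀ |Col₀ − Col₁| + |Row₀ − Row₁| Col₀ ≤ 2 e^{−κ} C(2ℓ,ℓ)² ‖X|_{A∪B}‖_∞` (un-normalised).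
[cite: BraunEtAl2012, §3.1 Step 4 (3.31)–(3.33) (p. 11)] -/
theorem term_le_of_not_big {T : Finset α × Finset α × α} (hT : T ∈ frames α k) (f g : Finset α → ℝ)
    (hf : ∀ x, 0 ≤ f x) (hg : ∀ x, 0 ≤ g x) {N : ℝ} (hN : ∀ a b : Finset α, (a ∩ b).card ≤ 1 → f a * g b ≤ N)
    {κ : ℝ} (hsmall : ¬ Big k f κ (insert T.2.2 T.1)) :
    lo k f T * |lo k g (swap T) - hi k g (swap T)| + |lo k f T - hi k f T| * lo k g (swap T) ≤
      2 * Real.exp (-κ) * ((2 * k + 2).choose (k + 1) : ℝ) ^ 2 * N := by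
  rcases mem_frames.1 hT with ⟨-, h2, -, -, h5⟩
  set C := ((2 * k + 2).choose (k + 1) : ℝ) with hC
  set F := full k f (insert T.2.2 T.1) with hFdef
  set G := full k g (insert T.2.2 T.2.1) with hGdef
  have hF : lo k f T + hi k f T = F := lo_add_hi_frame hT f
  have hG : lo k g (swap T) + hi k g (swap T) = G := lo_add_hi_frame (swap_mem_frames hT) g
  have hlo : 0 ≤ lo k f T := Finset.sum_nonneg fun x _ => hf x
  have hhi : 0 ≤ hi k f T := Finset.sum_nonneg fun x _ => hf _
  have hlo' : 0 ≤ lo k g (swap T) := Finset.sum_nonneg fun x _ => hg x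
  have hhi' : 0 ≤ hi k g (swap T) := Finset.sum_nonneg fun x _ => hg _
  have hF0 : 0 ≤ F := by rw [← hF]; positivity
  have hG0 : 0 ≤ G := by rw [← hG]; positivity
  have hN0 : 0 ≤ N := nonneg_of_maxNorm hf hg hN
  -- `term ≤ 2 F G`
  have a1 : |lo k g (swap T) - hi k g (swap T)| ≤ G := by
    rw [← hG]
    exact (abs_sub _ _).trans (by rw [abs_of_nonneg hlo', abs_of_nonneg hhi'])
  have a2 : |lo k f T - hi k f T| ≤ F := by
    rw [← hF]
    exact (abs_sub _ _).trans (by rw [abs_of_nonneg hlo, abs_of_nonneg hhi])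
  have a3 : lo k f T ≤ F := by rw [← hF]; linarith
  have a4 : lo k g (swap T) ≤ G := by rw [← hG]; linarith
  have hterm : lo k f T * |lo k g (swap T) - hi k g (swap T)| + |lo k f T - hi k f T| * lo k g (swap T) ≤
      2 * (F * G) := by
    have b1 : lo k f T * |lo k g (swap T) - hi k g (swap T)| ≤ F * G := mul_le_mul a3 a1 (abs_nonneg _) hF0
    have b2 : |lo k f T - hi k f T| * lo k g (swap T) ≤ F * G := mul_le_mul a2 a4 hlo' hF0
    linarith
  -- `F G ≤ e^{-κ} C² N`
  have hsmall' : ∃ x ∈ (insert T.2.2 T.1).powersetCard (k + 1), Real.exp κ * F < f x * C := by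
    by_contra hcon
    refine hsmall fun x hx => ?_
    exact not_lt.1 fun hlt => hcon ⟨x, hx, hlt⟩
  obtain ⟨x, hx, hlt⟩ := hsmall'
  have hfG : f x * G ≤ C * N := by
    rw [hGdef]
    unfold full
    rw [Finset.mul_sum]
    calc ∑ y ∈ (insert T.2.2 T.2.1).powersetCard (k + 1), f x * g y
        ≤ ∑ y ∈ (insert T.2.2 T.2.1).powersetCard (k + 1), N :=
          Finset.sum_le_sum fun y hy => hN x y (card_inter_le_one_of_subset hT
            (Finset.mem_powersetCard.1 hx).1 (Finset.mem_powersetCard.1 hy).1)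
      _ = C * N := by
          rw [Finset.sum_const, nsmul_eq_mul, Finset.card_powersetCard, Finset.card_insert_of_notMem h5, h2]
  have hFG : F * G ≤ Real.exp (-κ) * C ^ 2 * N := by
    have hC0 : 0 ≤ C := by rw [hC]; positivity
    have h1 : Real.exp κ * (F * G) ≤ C ^ 2 * N := by
      calc Real.exp κ * (F * G) = (Real.exp κ * F) * G := by ring
        _ ≤ (f x * C) * G := mul_le_mul_of_nonneg_right hlt.le hG0
        _ = C * (f x * G) := by ring
        _ ≤ C * (C * N) := mul_le_mul_of_nonneg_left hfG hC0
        _ = C ^ 2 * N := by ring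
    calc F * G = Real.exp (-κ) * (Real.exp κ * (F * G)) := by
          rw [← mul_assoc, ← Real.exp_add, neg_add_cancel, Real.exp_zero, one_mul]
      _ ≤ Real.exp (-κ) * (C ^ 2 * N) := mul_le_mul_of_nonneg_left h1 (Real.exp_pos _).le
      _ = Real.exp (-κ) * C ^ 2 * N := by ring
  linarith

/-- **The per-frame split** ((3.16)–(3.17) with Step 4): `term(T) ≤ I_{E_rowbig} |Row₀ − Row₁| Col₀ +
I_{E_colbig} Row₀ |Col₀ − Col₁| + 2 e^{−κ} C(2ℓ,ℓ)² ‖X‖_∞`. [cite: BraunEtAl2012, §3.1 Step 2 (3.16)–(3.17)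
and Step 4 (p. 10–11)] -/
theorem term_le {T : Finset α × Finset α × α} (hT : T ∈ frames α k) (f g : Finset α → ℝ)
    (hf : ∀ x, 0 ≤ f x) (hg : ∀ x, 0 ≤ g x) {N : ℝ} (hN : ∀ a b : Finset α, (a ∩ b).card ≤ 1 → f a * g b ≤ N)
    (κ : ℝ) :
    lo k f T * |lo k g (swap T) - hi k g (swap T)| + |lo k f T - hi k f T| * lo k g (swap T) ≤
      bigInd k f κ (insert T.2.2 T.1) * (|lo k f T - hi k f T| * full k g T.2.1) +
      bigInd k g κ (insert T.2.2 T.2.1) * (|lo k g (swap T) - hi k g (swap T)| * full k f T.1) +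
      2 * Real.exp (-κ) * ((2 * k + 2).choose (k + 1) : ℝ) ^ 2 * N := by
  have hN' : ∀ a b : Finset α, (a ∩ b).card ≤ 1 → g a * f b ≤ N := fun a b h => by
    rw [mul_comm]; exact hN b a (by rwa [Finset.inter_comm])
  have hN0 : 0 ≤ N := nonneg_of_maxNorm hf hg hN
  have hlo : 0 ≤ lo k f T := Finset.sum_nonneg fun x _ => hf x
  have hlo' : 0 ≤ lo k g (swap T) := Finset.sum_nonneg fun x _ => hg x
  have e1 : full k g T.2.1 = lo k g (swap T) := rfl
  have e2 : full k f T.1 = lo k f T := rfl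
  have hrest : 0 ≤ 2 * Real.exp (-κ) * ((2 * k + 2).choose (k + 1) : ℝ) ^ 2 * N := by positivity
  by_cases hBf : Big k f κ (insert T.2.2 T.1)
  · by_cases hBg : Big k g κ (insert T.2.2 T.2.1)
    · rw [bigInd_of_big hBf, bigInd_of_big hBg, e1, e2]
      nlinarith [abs_nonneg (lo k g (swap T) - hi k g (swap T)), abs_nonneg (lo k f T - hi k f T)]
    · -- column-small: Step 4 for the swapped frame
      have h := term_le_of_not_big (swap_mem_frames hT) g f hg hf hN' (κ := κ) hBg
      simp only [swap_swap] at h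
      have t1 : 0 ≤ bigInd k f κ (insert T.2.2 T.1) * (|lo k f T - hi k f T| * full k g T.2.1) :=
        mul_nonneg (bigInd_nonneg _ _ _) (mul_nonneg (abs_nonneg _) (Finset.sum_nonneg fun x _ => hg x))
      have t2 : 0 ≤ bigInd k g κ (insert T.2.2 T.2.1) * (|lo k g (swap T) - hi k g (swap T)| * full k f T.1) :=
        mul_nonneg (bigInd_nonneg _ _ _) (mul_nonneg (abs_nonneg _) (Finset.sum_nonneg fun x _ => hf x))
      have : lo k f T * |lo k g (swap T) - hi k g (swap T)| + |lo k f T - hi k f T| * lo k g (swap T) =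
          lo k g (swap T) * |lo k f T - hi k f T| + |lo k g (swap T) - hi k g (swap T)| * lo k f T := by ring
      linarith
  · have h := term_le_of_not_big hT f g hf hg hN (κ := κ) hBf
    have t1 : 0 ≤ bigInd k f κ (insert T.2.2 T.1) * (|lo k f T - hi k f T| * full k g T.2.1) :=
      mul_nonneg (bigInd_nonneg _ _ _) (mul_nonneg (abs_nonneg _) (Finset.sum_nonneg fun x _ => hg x))
    have t2 : 0 ≤ bigInd k g κ (insert T.2.2 T.2.1) * (|lo k g (swap T) - hi k g (swap T)| * full k f T.1) :=
      mul_nonneg (bigInd_nonneg _ _ _) (mul_nonneg (abs_nonneg _) (Finset.sum_nonneg fun x _ => hf x))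
    linarith

/-- `C(2k+2, k+1) = 2·C(2k+1, k)` (Pascal + symmetry). [cite: BraunEtAl2012, §3.1 Step 3 (p. 10,
"`C(2ℓ−1, ℓ−1) = C(2ℓ−1, ℓ)`")] -/
theorem choose_window (k : ℕ) : (2 * k + 2).choose (k + 1) = 2 * (2 * k + 1).choose k := by
  rw [show 2 * k + 2 = (2 * k + 1) + 1 by ring, Nat.choose_succ_succ', choose_half]
  ring

/-- **BFPS Lemma 4 for a rank-one non-negative kernel (un-normalised; Steps 1–4 assembled).**  For
`ε > 0`, `f, g ≥ 0` and `N` with `f(a) g(b) ≤ N` whenever `|a ∩ b| ≤ 1`: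
`(1 − ε) · sumA(f ⊗ g) − 3 · sumB(f ⊗ g) ≤ 24 · 2ℓ · e^{−ε² ℓ / 36} · N · sumB(1)`, i.e. (dividing by
`sumA(1) = 3 sumB(1)`) `(1 − ε) E[X | A] − E[X | B] ≤ 16 ℓ e^{−ε² ℓ/36} ‖X|_{A∪B}‖_∞` — the printed
(3.2) `(1−ε) E[X|A] − E[X|B] ≤ ‖X|_{A∪B}‖_∞ 2^{−ε² ℓ/(16 ln 2) + O(log ℓ)}` with constant `1/36` and
`O(log ℓ) = log 16ℓ`. [cite: BraunEtAl2012, §3.1 Lemma 4 (3.2) (p. 9) and its proof (pp. 9–11)] -/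
theorem corruption_rankOne (k : ℕ) {ε : ℝ} (hε : 0 < ε) (f g : Finset α → ℝ) (hf : ∀ x, 0 ≤ f x)
    (hg : ∀ x, 0 ≤ g x) {N : ℝ} (hN : ∀ a b : Finset α, (a ∩ b).card ≤ 1 → f a * g b ≤ N) :
    (1 - ε) * sumA k (fun a b => f a * g b) - 3 * sumB k (fun a b => f a * g b) ≤
      24 * (2 * k + 2) * Real.exp (-(ε ^ 2 * (k + 1) / 36)) * N * sumB (α := α) k (fun _ _ => 1) := by
  set κ : ℝ := ε ^ 2 * (k + 1) / 36 - Real.log (2 * k + 2) with hκ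
  set C := ((2 * k + 2).choose (k + 1) : ℝ) with hC
  set SA := sumA k (fun a b => f a * g b) with hSA
  set SB := sumB k (fun a b => f a * g b) with hSB
  set Z := sumB (α := α) k (fun _ _ => 1) with hZ
  have hN0 : 0 ≤ N := nonneg_of_maxNorm hf hg hN
  -- the per-frame quantity bounded in Step 2
  set term : Finset α × Finset α × α → ℝ := fun T =>
    lo k f T * |lo k g (swap T) - hi k g (swap T)| + |lo k f T - hi k f T| * lo k g (swap T) with hterm
  -- Step 2, summed over frames
  have step2 : SA - 3 * SB ≤ 3 * ∑ T ∈ frames α k, term T := by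
    rw [hSA, hSB, sumA_mul, sumB_mul, Finset.mul_sum, ← Finset.sum_sub_distrib, Finset.mul_sum]
    refine Finset.sum_le_sum fun T _ => ?_
    have hlo : 0 ≤ lo k f T := Finset.sum_nonneg fun x _ => hf x
    have hhi : 0 ≤ hi k f T := Finset.sum_nonneg fun x _ => hf _
    have hlo' : 0 ≤ lo k g (swap T) := Finset.sum_nonneg fun x _ => hg x
    have hhi' : 0 ≤ hi k g (swap T) := Finset.sum_nonneg fun x _ => hg _
    have h2 := step_two hlo hhi hlo' hhi'
    simp only [hterm]
    linarith
  -- the per-frame split, summed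
  set R := 2 * Real.exp (-κ) * C ^ 2 * N with hR
  have split : ∑ T ∈ frames α k, term T ≤
      ∑ T ∈ frames α k, bigInd k f κ (insert T.2.2 T.1) * (|lo k f T - hi k f T| * full k g T.2.1) +
      ∑ T ∈ frames α k, bigInd k g κ (insert T.2.2 T.2.1) * (|lo k g (swap T) - hi k g (swap T)| * full k f T.1) +
      (frames α k).card * R := by
    rw [← Finset.sum_add_distrib, show ((frames α k).card : ℝ) * R = ∑ T ∈ frames α k, R by
      rw [Finset.sum_const, nsmul_eq_mul], ← Finset.sum_add_distrib]
    exact Finset.sum_le_sum fun T hT => term_le hT f g hf hg hN κ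
  -- Step 3 for rows and (by symmetry) for columns
  set c := Real.sqrt ((2 * k + 2) * (2 * (κ + Real.log (2 * k + 2)))) / (2 * k + 2) with hc
  have row := rowBig (k := k) f hf (full k g) (fun S => Finset.sum_nonneg fun x _ => hg x) κ
  have col : ∑ T ∈ frames α k, bigInd k g κ (insert T.2.2 T.2.1) *
      (|lo k g (swap T) - hi k g (swap T)| * full k f T.1) ≤
      c * ∑ T ∈ frames α k, (lo k g (swap T) + hi k g (swap T)) * full k f T.1 := by
    have h1 := rowBig (k := k) g hg (full k f) (fun S => Finset.sum_nonneg fun x _ => hf x) κ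
    rw [← sum_frames_swap k (fun S => bigInd k g κ (insert S.2.2 S.1) * (|lo k g S - hi k g S| * full k f S.2.1)),
      ← sum_frames_swap k (fun S => (lo k g S + hi k g S) * full k f S.2.1)] at h1
    exact h1
  -- the two right-hand sides together are at most `2 · sumA`
  have comb : ∑ T ∈ frames α k, (lo k f T + hi k f T) * full k g T.2.1 +
      ∑ T ∈ frames α k, (lo k g (swap T) + hi k g (swap T)) * full k f T.1 ≤ 2 * SA := by
    rw [hSA, sumA_mul, Finset.mul_sum, ← Finset.sum_add_distrib]
    refine Finset.sum_le_sum fun T _ => ?_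
    have hlo : 0 ≤ lo k f T := Finset.sum_nonneg fun x _ => hf x
    have hhi : 0 ≤ hi k f T := Finset.sum_nonneg fun x _ => hf _
    have hlo' : 0 ≤ lo k g (swap T) := Finset.sum_nonneg fun x _ => hg x
    have hhi' : 0 ≤ hi k g (swap T) := Finset.sum_nonneg fun x _ => hg _
    change (lo k f T + hi k f T) * lo k g (swap T) + (lo k g (swap T) + hi k g (swap T)) * lo k f T ≤
      2 * (lo k f T * lo k g (swap T) + hi k f T * lo k g (swap T) + lo k f T * hi k g (swap T))
    nlinarith [mul_nonneg hhi hlo', mul_nonneg hlo hhi']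
  -- constants: `c = ε/6`, `e^{-κ} = (2k+2) e^{-ε²(k+1)/36}`, `C² |frames| = 4 Z`
  have hk2 : (0 : ℝ) < 2 * k + 2 := by positivity
  have hcε : c = ε / 6 := by
    rw [hc, hκ]
    have : (2 * k + 2 : ℝ) * (2 * (ε ^ 2 * (k + 1) / 36 - Real.log (2 * k + 2) + Real.log (2 * k + 2))) =
        (ε * (k + 1) / 3) ^ 2 := by ring
    rw [this, Real.sqrt_sq (by positivity)]
    field_simp
    ring
  have hexp : Real.exp (-κ) = (2 * k + 2) * Real.exp (-(ε ^ 2 * (k + 1) / 36)) := by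
    rw [hκ, neg_sub, Real.exp_sub, Real.exp_log hk2, Real.exp_neg]
    field_simp
  have hCZ : C ^ 2 * (frames α k).card = 4 * Z := by
    rw [hZ, sumB_one, hC, choose_window]
    push_cast
    ring
  have hc0 : 0 ≤ c := by rw [hcε]; positivity
  -- assemble
  have big_total : ∑ T ∈ frames α k, bigInd k f κ (insert T.2.2 T.1) * (|lo k f T - hi k f T| * full k g T.2.1) +
      ∑ T ∈ frames α k, bigInd k g κ (insert T.2.2 T.2.1) *
        (|lo k g (swap T) - hi k g (swap T)| * full k f T.1) ≤ c * (2 * SA) := by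
    have := add_le_add row col
    rw [← mul_add] at this
    exact this.trans (mul_le_mul_of_nonneg_left comb hc0)
  have hRZ : ((frames α k).card : ℝ) * R = 8 * (2 * k + 2) * Real.exp (-(ε ^ 2 * (k + 1) / 36)) * N * Z := by
    rw [hR, hexp]
    have : ((frames α k).card : ℝ) * (2 * ((2 * k + 2) * Real.exp (-(ε ^ 2 * (k + 1) / 36))) * C ^ 2 * N) =
        2 * (2 * k + 2) * Real.exp (-(ε ^ 2 * (k + 1) / 36)) * N * (C ^ 2 * (frames α k).card) := by ring
    rw [this, hCZ]
    ring
  have final : SA - 3 * SB ≤ ε * SA + 24 * (2 * k + 2) * Real.exp (-(ε ^ 2 * (k + 1) / 36)) * N * Z := by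
    have h1 := step2.trans (mul_le_mul_of_nonneg_left (split.trans (add_le_add big_total le_rfl)) (by norm_num))
    rw [hRZ, hcε] at h1
    linarith
  linarith


/-! ### From kernels to measures: point masses and rectangles -/

/-- The point-mass kernel `δ_{(a,b)}`. [cite: BraunEtAl2012, §3.1 Lemma 4 (rectangle case: "`X = I_R`",
p. 9)] -/
def delta (a b : Finset α) : Finset α → Finset α → ℝ :=
  fun a' b' => (if a' = a then 1 else 0) * (if b' = b then 1 else 0)

/-- The rectangle kernel `I_{X × Y} = 1_X ⊗ 1_Y`. [cite: BraunEtAl2012, §3.1 Lemma 4 (rectangle case, p. 9)] -/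
def rect (X Y : Finset (Finset α)) : Finset α → Finset α → ℝ :=
  fun a' b' => (if a' ∈ X then 1 else 0) * (if b' ∈ Y then 1 else 0)

omit [Fintype α] in
/-- `1_X ⊗ 1_Y = Σ_{a ∈ X, b ∈ Y} δ_{(a,b)}` pointwise. [cite: BraunEtAl2012, §3.1 (p. 9)] -/
theorem rect_eq_sum_delta (X Y : Finset (Finset α)) :
    rect X Y = fun a' b' => ∑ a ∈ X, ∑ b ∈ Y, delta a b a' b' := by
  funext a' b'
  unfold rect delta
  rw [← Finset.sum_mul_sum, Finset.sum_ite_eq, Finset.sum_ite_eq]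

/-- Rectangle masses of the `A`-functional from point masses. [cite: BraunEtAl2012, §3.1 (p. 9)] -/
theorem sum_sum_sumA_delta (X Y : Finset (Finset α)) :
    ∑ a ∈ X, ∑ b ∈ Y, sumA k (delta a b) = sumA k (rect X Y) := by
  rw [rect_eq_sum_delta, sumA_finset_sum]
  refine Finset.sum_congr rfl fun a _ => ?_
  rw [← sumA_finset_sum]

/-- Rectangle masses of the `B`-functional from point masses. [cite: BraunEtAl2012, §3.1 (p. 9)] -/
theorem sum_sum_sumB_delta (X Y : Finset (Finset α)) :
    ∑ a ∈ X, ∑ b ∈ Y, sumB k (delta a b) = sumB k (rect X Y) := by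
  rw [rect_eq_sum_delta, sumB_finset_sum]
  refine Finset.sum_congr rfl fun a _ => ?_
  rw [← sumB_finset_sum]

/-- `rect univ univ = 1`. [cite: BraunEtAl2012, §3.1 (p. 9)] -/
theorem rect_univ : rect (α := α) Finset.univ Finset.univ = fun _ _ => 1 := by
  funext a b; simp [rect]

/-- The `A`-functional only sees disjoint pairs. [cite: BraunEtAl2012, §3.1 Step 1 (support of `μ` on
`A ∪ B`, p. 9)] -/
theorem sumA_delta_eq_zero {a b : Finset α} (h : ¬ Disjoint a b) : sumA k (delta a b) = 0 := by
  have : ∀ a' b' : Finset α, Disjoint a' b' → delta a b a' b' = 0 := by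
    intro a' b' hd
    unfold delta
    by_cases ha : a' = a
    · by_cases hb : b' = b
      · subst ha; subst hb; exact absurd hd h
      · simp [hb]
    · simp [ha]
  rw [sumA_eq_of_disjoint this, zero_mul]

/-- The `B`-functional only sees pairs of `ℓ`-sets meeting in exactly one point.
[cite: BraunEtAl2012, §3.1 Step 1 (support of `μ` on `A ∪ B`, p. 9)] -/
theorem sumB_delta_eq_zero {a b : Finset α}
    (h : ¬ ((a ∩ b).card = 1 ∧ a.card = k + 1 ∧ b.card = k + 1)) : sumB k (delta a b) = 0 := by
  unfold sumB
  refine Finset.sum_eq_zero fun T hT => Finset.sum_eq_zero fun x hx => Finset.sum_eq_zero fun y hy => ?_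
  unfold delta
  by_cases ha : insert T.2.2 x = a
  · by_cases hb : insert T.2.2 y = b
    · exfalso
      refine h ⟨?_, ?_, ?_⟩
      · rw [← ha, ← hb]; exact card_inter_insert hT hx hy
      · rw [← ha, Finset.card_insert_of_notMem (pivot_notMem_left hT hx), (Finset.mem_powersetCard.1 hx).2]
      · rw [← hb, Finset.card_insert_of_notMem (pivot_notMem_right hT hy), (Finset.mem_powersetCard.1 hy).2]
    · simp [hb]
  · simp [ha]

/-- Point masses have non-negative `A`-mass. [cite: BraunEtAl2012, §3.1 (p. 9)] -/
theorem sumA_delta_nonneg (a b : Finset α) : 0 ≤ sumA k (delta a b) := by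
  have : sumA (α := α) k (fun _ _ => (0 : ℝ)) = 0 := by
    rw [sumA_eq_of_disjoint (c := 0) (fun _ _ _ => rfl), zero_mul]
  rw [← this]
  exact sumA_mono fun a' b' => by unfold delta; positivity

/-- Point masses have non-negative `B`-mass. [cite: BraunEtAl2012, §3.1 (p. 9)] -/
theorem sumB_delta_nonneg (a b : Finset α) : 0 ≤ sumB k (delta a b) := by
  have : sumB (α := α) k (fun _ _ => (0 : ℝ)) = 0 := by
    rw [sumB_eq_of_card_inter (c := 0) (fun _ _ _ => rfl), zero_mul]
  rw [← this]
  exact sumB_mono fun a' b' => by unfold delta; positivity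

/-- **The rectangle corollary** (Lemma 4 with `X = I_R`, `ε = 1/2`, normalised):
`μ_A(X × Y) ≤ 2 μ_B(X × Y) + 16 · 2ℓ · e^{−ℓ/144}` for the frame measures `μ_A = sumA(δ)/sumA(1)`,
`μ_B = sumB(δ)/sumB(1)`. [cite: BraunEtAl2012, §3.1 Lemma 4, rectangle case
("`(1−ε) P(R|A) − P(R|B) ≤ 2^{−ε²ℓ/(16 ln 2) + O(log ℓ)}`", p. 9)] -/
theorem rect_corruption (hne : (frames α k).Nonempty) (X Y : Finset (Finset α)) :
    sumA k (rect X Y) / sumA (α := α) k (fun _ _ => 1) ≤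
      2 * (sumB k (rect X Y) / sumB (α := α) k (fun _ _ => 1)) +
        16 * (2 * k + 2) * Real.exp (-((k + 1 : ℝ) / 144)) := by
  have hZ := sumB_one_pos hne
  have hmain : (1 - 1 / 2) * sumA k (rect X Y) - 3 * sumB k (rect X Y) ≤
      24 * (2 * k + 2) * Real.exp (-((1 / 2 : ℝ) ^ 2 * (k + 1) / 36)) * 1 * sumB (α := α) k (fun _ _ => 1) :=
    corruption_rankOne k (by norm_num) (fun a => if a ∈ X then (1 : ℝ) else 0)
      (fun b => if b ∈ Y then (1 : ℝ) else 0) (fun a => by positivity) (fun b => by positivity)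
      (fun a b _ => by split_ifs <;> norm_num)
  rw [show (1 / 2 : ℝ) ^ 2 * (k + 1) / 36 = (k + 1 : ℝ) / 144 by ring] at hmain
  rw [sumA_one, div_le_iff₀ (by positivity)]
  have : (2 * (sumB k (rect X Y) / sumB (α := α) k fun _ _ => 1) + 16 * (2 * k + 2) * Real.exp (-((k + 1 : ℝ) / 144))) *
      (3 * sumB (α := α) k fun _ _ => 1) = 6 * sumB k (rect X Y) +
        48 * (2 * k + 2) * Real.exp (-((k + 1 : ℝ) / 144)) * sumB (α := α) k (fun _ _ => 1) := by
    field_simp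
    ring
  rw [this]
  linarith

end UdisjFrames

/-! ### The discharge -/

section Discharge

open UdisjFrames

/-- Arithmetic of the error term: with `ℓ = ⌊(n+1)/4⌋ ≥ 1`, `16 · 2ℓ · e^{−ℓ/144} ≤ A / 2^{⌊n/600⌋}` for
`A = 16 e^{1/288} / (1/576 − log 2/600)` (`2ℓ ≤ n`, `ℓ ≥ (n−2)/4`, `d n ≤ e^{d n}`).
[cite: BraunEtAl2012, §3.1 Lemma 4 (the error `2^{−Ω(ℓ) + O(log ℓ)}`, p. 9)] -/
private theorem error_term_le (n : ℕ) (hn : 3 ≤ n) :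
    16 * (2 * (((n + 1) / 4 - 1 : ℕ) : ℝ) + 2) * Real.exp (-(((((n + 1) / 4 - 1 : ℕ) : ℝ) + 1) / 144)) ≤
      16 * Real.exp (1 / 288) / (1 / 576 - Real.log 2 / 600) / 2 ^ (n / 600) := by
  set ℓ := (n + 1) / 4 with hℓ
  have hℓ1 : 1 ≤ ℓ := by omega
  have hcast : (((ℓ - 1 : ℕ) : ℝ) + 1) = ℓ := by
    rw [Nat.cast_sub hℓ1]; push_cast; ring
  have h2ℓ : (2 : ℝ) * ((ℓ - 1 : ℕ) : ℝ) + 2 = 2 * ℓ := by rw [Nat.cast_sub hℓ1]; push_cast; ring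
  rw [hcast, h2ℓ]
  set d : ℝ := 1 / 576 - Real.log 2 / 600 with hd
  have hdpos : 0 < d := by
    have := Real.log_two_lt_d9; rw [hd]; linarith
  have hlog2 : 0 < Real.log 2 := Real.log_pos one_lt_two
  -- `2ℓ ≤ n` and `ℓ ≥ (n - 2)/4`
  have h4 : 4 * ℓ ≤ n + 1 := Nat.mul_div_le (n + 1) 4
  have h4' : n ≤ 4 * ℓ + 2 := by omega
  have hℓn : (2 : ℝ) * ℓ ≤ n := by exact_mod_cast (by omega : 2 * ℓ ≤ n)
  have hℓlow : -((ℓ : ℝ) / 144) ≤ -(((n : ℝ) - 2) / 576) := by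
    have : ((n : ℝ)) ≤ 4 * ℓ + 2 := by exact_mod_cast h4'
    linarith
  -- `n e^{-d n} ≤ 1/d`
  have hnexp : (n : ℝ) * Real.exp (-(d * n)) ≤ 1 / d := by
    have h1 : d * n ≤ Real.exp (d * n) := by linarith [Real.add_one_le_exp (d * n)]
    rw [Real.exp_neg, le_div_iff₀ hdpos]
    have hpos := Real.exp_pos (d * n)
    calc (n : ℝ) * (Real.exp (d * n))⁻¹ * d = (d * n) / Real.exp (d * n) := by ring
      _ ≤ Real.exp (d * n) / Real.exp (d * n) := div_le_div_of_nonneg_right h1 hpos.le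
      _ = 1 := div_self hpos.ne'
  -- `2^{⌊n/600⌋} ≤ e^{n log 2 / 600}`
  have hpow : (2 : ℝ) ^ (n / 600) ≤ Real.exp ((n : ℝ) * Real.log 2 / 600) := by
    have hq : ((n / 600 : ℕ) : ℝ) ≤ (n : ℝ) / 600 := Nat.cast_div_le
    calc (2 : ℝ) ^ (n / 600) = Real.exp (((n / 600 : ℕ) : ℝ) * Real.log 2) := by
          rw [← Real.rpow_natCast, Real.rpow_def_of_pos (by norm_num : (0:ℝ) < 2), mul_comm]
      _ ≤ Real.exp ((n : ℝ) * Real.log 2 / 600) := by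
          apply Real.exp_le_exp.2
          have h := mul_le_mul_of_nonneg_right hq hlog2.le
          linarith
  have hpow0 : (0 : ℝ) < 2 ^ (n / 600) := by positivity
  -- combine
  rw [le_div_iff₀ hpow0]
  calc 16 * (2 * (ℓ : ℝ)) * Real.exp (-((ℓ : ℝ) / 144)) * 2 ^ (n / 600)
      ≤ 16 * n * Real.exp (-(((n : ℝ) - 2) / 576)) * Real.exp ((n : ℝ) * Real.log 2 / 600) := by
        have e1 : Real.exp (-((ℓ : ℝ) / 144)) ≤ Real.exp (-(((n : ℝ) - 2) / 576)) := Real.exp_le_exp.2 hℓlow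
        have := Real.exp_pos (-((ℓ : ℝ) / 144))
        gcongr
    _ = 16 * Real.exp (1 / 288) * ((n : ℝ) * Real.exp (-(d * n))) := by
        rw [hd]
        have : -(((n : ℝ) - 2) / 576) = 1 / 288 + (-( (n:ℝ) / 576)) := by ring
        rw [this, Real.exp_add]
        have : -((1 / 576 - Real.log 2 / 600) * (n : ℝ)) = -((n : ℝ) / 576) + (n : ℝ) * Real.log 2 / 600 := by ring
        rw [this, Real.exp_add]
        ring
    _ ≤ 16 * Real.exp (1 / 288) * (1 / d) := by gcongr
    _ = 16 * Real.exp (1 / 288) / d := by ring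

/-- **Discharge of `udisjCorruption`** (Razborov's corruption lemma, rectangle / measure form) from the
frame functionals: `m = 600`, `κ = 2`, `A = 16 e^{1/288}/(1/576 − log 2/600)`; for `n ≥ 3`,
`μd = sumA(δ)/sumA(1)` (uniform over the disjoint frame pairs) and `μo = sumB(δ)/sumB(1)` (uniform over
the frame pairs of `ℓ`-sets meeting in the pivot, `ℓ = ⌊(n+1)/4⌋`); for `n ≤ 2`, `μd = δ_{(∅,∅)}`, `μo = 0`.
[cite: Razborov1992Disjointness, Main Lemma] [cite: BraunEtAl2012, §3.1 Lemma 4 (p. 9) and its proof,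
Steps 1–4 (pp. 9–11)] -/
theorem udisjCorruption_holds : udisjCorruption := by
  classical
  set d : ℝ := 1 / 576 - Real.log 2 / 600 with hd
  have hdpos : 0 < d := by
    have := Real.log_two_lt_d9; rw [hd]; linarith
  have hd1 : d ≤ 1 := by
    have := Real.log_pos (one_lt_two : (1 : ℝ) < 2); rw [hd]; linarith
  set A : ℝ := 16 * Real.exp (1 / 288) / d with hA
  have hA1 : 1 ≤ A := by
    rw [hA, le_div_iff₀ hdpos]
    have : (1 : ℝ) ≤ Real.exp (1 / 288) := Real.one_le_exp (by norm_num)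
    nlinarith
  refine ⟨600, 2, A, by norm_num, by norm_num, by linarith, fun n => ?_⟩
  by_cases hn : n < 3
  · -- degenerate sizes: a point mass on `(∅, ∅)` and the zero measure
    refine ⟨fun a b => if a = ∅ ∧ b = ∅ then 1 else 0, fun _ _ => 0, fun a b => by positivity,
      fun _ _ => le_rfl, fun a b h => ?_, fun a b h => absurd rfl h, fun a b h => absurd rfl h, ?_, by simp, ?_⟩
    · by_cases hab : a = ∅ ∧ b = ∅
      · rw [hab.1]; exact Finset.disjoint_empty_left _
      · exact absurd (if_neg hab) h
    · rw [Fintype.sum_eq_single ∅ fun a ha => by simp [ha], Fintype.sum_eq_single ∅ fun b hb => by simp [hb]]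
      simp
    · intro X Y
      have hq : n / 600 = 0 := by omega
      rw [hq, pow_zero, div_one]
      simp only [Finset.sum_const_zero, mul_zero, zero_add]
      calc ∑ a ∈ X, ∑ b ∈ Y, (if a = ∅ ∧ b = ∅ then (1 : ℝ) else 0)
          ≤ ∑ a, ∑ b, (if a = ∅ ∧ b = ∅ then (1 : ℝ) else 0) := by
            refine (Finset.sum_le_sum_of_subset_of_nonneg (Finset.subset_univ X) fun a _ _ => by positivity).trans ?_
            exact Finset.sum_le_sum fun a _ =>
              Finset.sum_le_sum_of_subset_of_nonneg (Finset.subset_univ Y) fun b _ _ => by positivity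
        _ = 1 := by
            rw [Fintype.sum_eq_single ∅ fun a ha => by simp [ha], Fintype.sum_eq_single ∅ fun b hb => by simp [hb]]
            simp
        _ ≤ A := hA1
  · push Not at hn
    set k := (n + 1) / 4 - 1 with hk
    have hk1 : k + 1 = (n + 1) / 4 := by omega
    have hne : (frames (Fin n) k).Nonempty := frames_nonempty (by rw [Fintype.card_fin]; omega)
    have hZB := sumB_one_pos hne
    have hZA : 0 < sumA (α := Fin n) k (fun _ _ => 1) := by rw [sumA_one]; positivity
    refine ⟨fun a b => sumA k (delta a b) / sumA (α := Fin n) k (fun _ _ => 1),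
      fun a b => sumB k (delta a b) / sumB (α := Fin n) k (fun _ _ => 1),
      fun a b => div_nonneg (sumA_delta_nonneg a b) hZA.le,
      fun a b => div_nonneg (sumB_delta_nonneg a b) hZB.le, fun a b h => ?_, fun a b h => ?_, fun a b h => ?_,
      ?_, ?_, fun X Y => ?_⟩
    · by_contra hd'
      have h0 : sumA k (delta a b) = 0 := sumA_delta_eq_zero hd'
      exact h (by simp only [h0, zero_div])
    · by_contra hc
      have h0 : sumB k (delta a b) = 0 := sumB_delta_eq_zero fun h3 => hc h3.1
      exact h (by simp only [h0, zero_div])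
    · rw [← hk1]
      by_contra hc
      have h0 : sumB k (delta a b) = 0 := sumB_delta_eq_zero fun h3 => hc h3.2
      exact h (by simp only [h0, zero_div])
    · show ∑ a, ∑ b, sumA k (delta a b) / sumA (α := Fin n) k (fun _ _ => 1) = 1
      simp_rw [div_eq_mul_inv, ← Finset.sum_mul]
      rw [sum_sum_sumA_delta, rect_univ, mul_inv_cancel₀ hZA.ne']
    · show ∑ a, ∑ b, sumB k (delta a b) / sumB (α := Fin n) k (fun _ _ => 1) ≤ 1
      simp_rw [div_eq_mul_inv, ← Finset.sum_mul]
      rw [sum_sum_sumB_delta, rect_univ, mul_inv_cancel₀ hZB.ne']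
    · show ∑ a ∈ X, ∑ b ∈ Y, sumA k (delta a b) / sumA (α := Fin n) k (fun _ _ => 1) ≤
        2 * ∑ a ∈ X, ∑ b ∈ Y, sumB k (delta a b) / sumB (α := Fin n) k (fun _ _ => 1) + A / 2 ^ (n / 600)
      simp_rw [div_eq_mul_inv, ← Finset.sum_mul]
      rw [sum_sum_sumA_delta, sum_sum_sumB_delta, ← div_eq_mul_inv, ← div_eq_mul_inv]
      have h1 := rect_corruption hne X Y
      have h2 := error_term_le n hn
      rw [← hd, ← hA, ← hk] at h2
      simp only [div_eq_mul_inv] at h1 h2 ⊢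
      linarith

end Discharge

end

end Literature.Computability.Complexity
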